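import Literature.MathematicalPhysics.QuantumFieldTheory.Balaban1983to89.B3Eq15ChargeDerivative

/-!
# `Balaban1983to89.B3Eq14TotalExponent` — T. Bałaban, *(Higgs)₂,₃ quantum fields in a finite volume. III.
Renormalization*, Commun. Math. Phys. **88** (1983) 411–445 [Balaban1983Higgs3], (1.3)–(1.5) p. 412 [PDF 2]:
**the integrand `t(Ω;φ,φ′)·exp[…](φ′)` of the auxiliary function `E_k(e′, λ′, Ω, A^{(k)}, φ)` of (1.4) is
`C_κ·exp(−W(e′, λ′))` for ONE smooth TOTAL EXPONENT `W`, jointly `C^m` in the two expansion parameters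
`p = (e′, λ′)` of (1.5), all of whose `p`-derivatives of order `≤ m` are bounded by
`B·(1 + ‖A′‖)^m·(1 + Σ_x|φ′(x)|²)²`; hence (Faà di Bruno) every `p`-derivative of order `i ≤ m` of the integrand
is bounded by `i!·max(1, B(1+‖A′‖)^m(1+Σ|φ′|²)²)^i` times the integrand itself** — the pointwise input of the
joint `(e′, λ′)`-smoothness of `E_k` to all orders (successor file `B3Eq15JointSmooth`, which integrates these
bounds against the fluctuation Gaussians `Π_j dμ_{C^{(j)}}` and the fibre Lebesgue measure `dφ′↾_Ω`).  Companion of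
the typer's `B3Eq14LamAllOrders` (`λ′` alone, all orders), `B3Eq15ChargeDerivative` / `B3Eq15ChargeSecondOrder`
(`e′` to order 2 with closed vertex formulas); here no vertex is computed — only smoothness and growth.

statement-level skeleton of published theorems with citation tags; proofs where landed; nothing here is a claim about
the Yang–Mills mass gap

THE ARGUMENT (ours; what the double sum `Σ_{1≤α+β≤n̄}` of the printed (1.5) presupposes for the typed instance
`Data14.auxE`).  With `κ = a_k(L^kη)^{d−2}` and `φ′ = φ′↾_Ω` extended by `0`,
`t(Ω;φ,φ′)·exp[…](φ′) = (κ/2π)^{N|Ω^{(k)}|/2}·exp(−W(e′,λ′))`,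
`W = ½κΣ_{y∈Ω^{(k)}}|φ(y) − (Q_k(e′g_kA′+A^{(k)})φ′)(y)|² + ½⟨φ′,(−Δ^η_{e′g_kA′+A^{(k)},Ω} + m²(L^kε)²)φ′⟩
 + λ′λ(L^kε)Σ_{x∈Ω₁}η^d|φ′(x)|⁴ + ½Σ_{x∈Ω₁}η^dδm²(e′,λ′,x)(L^kε)²|φ′(x)|² + E₁(e′,λ′)` (`totalExponent`,
`kernel14_mul_density14_eq`).  The charge enters only through the transports `U(c + e′a) = exp(qηe(c + e′a))` of the
block averages (`𝒜(Γ) = A^{(k)}(Γ) + e′a_x(A′)`, `B3Eq15ChargeDerivative.contour13_extPieces`) and of the covariant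
derivatives (`𝒜(b) = A^{(k)}(b) + e′G_b(A′)`, `extField_apply`); along such an affine charge path
`∂ⁱ_{e′}U(c + e′a)w = (ηea·q)ⁱU(c + e′a)w`, of norm `≤ (|η||e||a|)ⁱ|w|` (`U` unitary, `‖q‖ ≤ 1`; `iteratedDeriv_uPath`,
`norm_iteratedDeriv_uPath_le`), and `|a_x(A′)|, |G_b(A′)| ≤ C‖A′‖`.  Sums, constant multiples, squares of norms
(Leibniz: `Σ_j C(i,j)θ^jθ^{i−j} = (2θ)^i`) and the `C^m` counterterm data then give, for `p` in any ball of radius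
`1`, `‖D^i_p W‖ ≤ B·θ(A′)^i·(1 + Σ|φ′|²)²` with `θ(A′) = 2(1 + |e|(C_a + η C_G)‖A′‖)` (`exists_norm_iteratedFDeriv_totalExponent_le`),
and Mathlib's `norm_iteratedFDeriv_comp_le` for `u ↦ C_κe^{−u}` composed with `W` gives the bound on the integrand
(`exists_norm_iteratedFDeriv_fibre14_le`).

WHAT IS PROVED (theorems; two `def`s — `uPath` (the transport along an affine charge path) and `totalExponent` —,
no `Prop` fact; axioms standard), for data `δm²(·,·,x)` (`x ∈ Ω₁`), `E₁` jointly `C^m` in `(e′, λ′)`: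
* §0 (private toolbox, [folklore]): bounds `‖D^i f‖ ≤ Kθ^i` are stable under sums, scalar multiples, composition
  with a coordinate projection, and squaring the norm;
* §1 `uPath`, `hasDerivAt_uPath`, `iteratedDeriv_uPath`, `contDiff_uPath`, `norm_iteratedDeriv_uPath_le`;
* §2 `totalExponent`, **`kernel14_mul_density14_eq`** (`t·exp[…] = C_κ e^{−W}`), **`contDiff_totalExponent`**,
  **`exists_norm_iteratedFDeriv_totalExponent_le`**;
* §3 **`contDiff_fibre14`** (the integrand is jointly `C^m` in `(e′, λ′)`),
  **`exists_norm_iteratedFDeriv_fibre14_le`** (`‖D^i_p(t·exp[…])‖ ≤ i!·max(1, B(1+‖A′‖)^m(1+Σ|φ′|²)²)^i·t·exp[…]`).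
HONEST SCOPE: pointwise (in the fields) smoothness and growth only — no integral, no statement about `E_k` itself
(that is `B3Eq15JointSmooth`); the regularity is that of the SUPPLIED data `Data14.dm2`, `Data14.E1`.

PDF held: `paper:balaban1983-higgs-2-3-quantum-fields-finite-volume` (journal page = PDF page + 410); (1.3)–(1.5)
p. 412 [PDF 2] read from the render `run/shared/lean/pub/pub-balaban/b2b-balaban-ref1/pages/` (paper III p002);
[Balaban1982Higgs1] (1.7) p. 605 (`U(A) = exp(qεeA)`, *"We will assume only that ‖q‖ ≤ 1"*), (2.4)–(2.6), (2.10)–(2.11)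
pp. 608–609 (the kernel `t` and the averages `Q_k`).

CITATION HEADER (lean-in-tree rule).  lit-balaban TYPED SKELETON (HOME `run/shared/lean/pub/lit-balaban/`), rows
**B3.Eq1.4** / **B3.Eq1.5** (owner r15; decls of record `B3Eq14AuxFunction.Data14.auxE`,
`B3Eq15OneSidedInteraction.interaction15R`); unit `lit-balaban-typer` (literature-prover-lit-balaban-typer-g27-0).
Nothing of any other seat is touched; no row changes head (regularity results about the typed instance).
-/

open _root_.MeasureTheory
open scoped InnerProductSpace

namespace Literature.MathematicalPhysics.QuantumFieldTheory.Balaban1983to89.B3Eq14TotalExponent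

open Literature.MathematicalPhysics.QuantumFieldTheory.Balaban1983to89.HiggsLattice
open Literature.MathematicalPhysics.QuantumFieldTheory.Balaban1983to89.HiggsAveraging
open Literature.MathematicalPhysics.QuantumFieldTheory.Balaban1983to89.HiggsCovariance
open Literature.MathematicalPhysics.QuantumFieldTheory.Balaban1983to89.HiggsCovariancePos
open Literature.MathematicalPhysics.QuantumFieldTheory.Balaban1983to89.B3MultiscaleFields
open Literature.MathematicalPhysics.QuantumFieldTheory.Balaban1983to89.HiggsFluctMeasure
open Literature.MathematicalPhysics.QuantumFieldTheory.Balaban1983to89.B1RT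
open Literature.MathematicalPhysics.QuantumFieldTheory.Balaban1983to89.B3Eq14AuxFunction
open Literature.MathematicalPhysics.QuantumFieldTheory.Balaban1983to89.B3Eq15OneSidedInteraction
  (sqSum sqSum_nonneg sq_le_sqSum)
open Literature.MathematicalPhysics.QuantumFieldTheory.Balaban1983to89.B3Eq14Finite
open Literature.MathematicalPhysics.QuantumFieldTheory.Balaban1983to89.B3Eq15ChargeDerivative
  (fluctContour fluctBond contour13_extPieces extField_apply exists_fluctContour_le exists_fluctBond_le
    norm_q_apply_le)
open Set Filter Topology Metric
open scoped BigOperators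

noncomputable section

variable {P : HiggsLattice.Params} {N : ℕ}

/-! ## 0. Toolbox: derivative bounds of the shape `‖D^i f(p)‖ ≤ K·θ^i` on `ℝ × ℝ` -/

section Toolbox

variable {F : Type*} [NormedAddCommGroup F] [NormedSpace ℝ F]

/-- `Σ_{j ≤ i} C(i, j)·θ^j·θ^{i−j} = (2θ)^i`. [folklore] -/
private theorem sum_choose_mul_pow_eq (θ : ℝ) (i : ℕ) :
    ∑ j ∈ Finset.range (i + 1), (i.choose j : ℝ) * θ ^ j * θ ^ (i - j) = (2 * θ) ^ i := by
  have h : ∀ j ∈ Finset.range (i + 1), (i.choose j : ℝ) * θ ^ j * θ ^ (i - j) = (i.choose j : ℝ) * θ ^ i := by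
    intro j hj
    have hji : j ≤ i := Nat.lt_succ_iff.mp (Finset.mem_range.mp hj)
    rw [mul_assoc, ← pow_add, Nat.add_sub_cancel' hji]
  rw [Finset.sum_congr rfl h, ← Finset.sum_mul, mul_pow]
  congr 1
  have h2 := (Nat.sum_range_choose i)
  have : (∑ j ∈ Finset.range (i + 1), (i.choose j : ℝ)) = ((∑ j ∈ Finset.range (i + 1), i.choose j : ℕ) : ℝ) := by
    push_cast; rfl
  rw [this, h2]
  push_cast
  ring

/-- **Sum rule.**  If `‖D^i f_j(p)‖ ≤ K_j θ^i` for all `j ∈ s`, `i ≤ m`, `p ∈ T` (each `f_j` of class `C^m`), then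
`‖D^i(Σ_j f_j)(p)‖ ≤ (Σ_j K_j) θ^i`. [folklore] -/
private theorem norm_iteratedFDeriv_sum_le {ι : Type*} (s : Finset ι) {m : ℕ} {T : Set (ℝ × ℝ)}
    {f : ι → ℝ × ℝ → F} {K : ι → ℝ} {θ : ℝ} (hf : ∀ j ∈ s, ContDiff ℝ m (f j))
    (hb : ∀ j ∈ s, ∀ i ≤ m, ∀ p ∈ T, ‖iteratedFDeriv ℝ i (f j) p‖ ≤ K j * θ ^ i) :
    ∀ i ≤ m, ∀ p ∈ T, ‖iteratedFDeriv ℝ i (fun q => ∑ j ∈ s, f j q) p‖ ≤ (∑ j ∈ s, K j) * θ ^ i := by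
  intro i hi p hp
  have him : (i : ℕ∞) ≤ m := by exact_mod_cast hi
  rw [iteratedFDeriv_sum fun j hj => ((hf j hj).of_le (by exact_mod_cast him)), Finset.sum_apply, Finset.sum_mul]
  exact (norm_sum_le _ _).trans (Finset.sum_le_sum fun j hj => hb j hj i hi p hp)

/-- **Sum of two.** [folklore] -/
private theorem norm_iteratedFDeriv_add_le {m : ℕ} {T : Set (ℝ × ℝ)} {f g : ℝ × ℝ → F} {K K' θ : ℝ}
    (hf : ContDiff ℝ m f) (hg : ContDiff ℝ m g)
    (hbf : ∀ i ≤ m, ∀ p ∈ T, ‖iteratedFDeriv ℝ i f p‖ ≤ K * θ ^ i)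
    (hbg : ∀ i ≤ m, ∀ p ∈ T, ‖iteratedFDeriv ℝ i g p‖ ≤ K' * θ ^ i) :
    ∀ i ≤ m, ∀ p ∈ T, ‖iteratedFDeriv ℝ i (fun q => f q + g q) p‖ ≤ (K + K') * θ ^ i := by
  intro i hi p hp
  have him : (i : ℕ∞) ≤ m := by exact_mod_cast hi
  have e : (fun q => f q + g q) = f + g := rfl
  rw [e, iteratedFDeriv_add_apply ((hf.of_le (by exact_mod_cast him)).contDiffAt)
    ((hg.of_le (by exact_mod_cast him)).contDiffAt), add_mul]
  exact (norm_add_le _ _).trans (add_le_add (hbf i hi p hp) (hbg i hi p hp))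

/-- **Difference of two.** [folklore] -/
private theorem norm_iteratedFDeriv_sub_le {m : ℕ} {T : Set (ℝ × ℝ)} {f g : ℝ × ℝ → F} {K K' θ : ℝ}
    (hf : ContDiff ℝ m f) (hg : ContDiff ℝ m g)
    (hbf : ∀ i ≤ m, ∀ p ∈ T, ‖iteratedFDeriv ℝ i f p‖ ≤ K * θ ^ i)
    (hbg : ∀ i ≤ m, ∀ p ∈ T, ‖iteratedFDeriv ℝ i g p‖ ≤ K' * θ ^ i) :
    ∀ i ≤ m, ∀ p ∈ T, ‖iteratedFDeriv ℝ i (fun q => f q - g q) p‖ ≤ (K + K') * θ ^ i := by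
  intro i hi p hp
  have him : (i : ℕ∞) ≤ m := by exact_mod_cast hi
  have e : (fun q => f q - g q) = f - g := rfl
  rw [e, iteratedFDeriv_sub_apply ((hf.of_le (by exact_mod_cast him)).contDiffAt)
    ((hg.of_le (by exact_mod_cast him)).contDiffAt), add_mul]
  exact (norm_sub_le _ _).trans (add_le_add (hbf i hi p hp) (hbg i hi p hp))

/-- **Scalar multiple** (real scalar on an `F`-valued map). [folklore] -/
private theorem norm_iteratedFDeriv_const_smul_le {m : ℕ} {T : Set (ℝ × ℝ)} {f : ℝ × ℝ → F} {K θ : ℝ} (c : ℝ)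
    (hf : ContDiff ℝ m f) (hbf : ∀ i ≤ m, ∀ p ∈ T, ‖iteratedFDeriv ℝ i f p‖ ≤ K * θ ^ i) :
    ∀ i ≤ m, ∀ p ∈ T, ‖iteratedFDeriv ℝ i (fun q => c • f q) p‖ ≤ (|c| * K) * θ ^ i := by
  intro i hi p hp
  have him : (i : ℕ∞) ≤ m := by exact_mod_cast hi
  rw [iteratedFDeriv_const_smul_apply' ((hf.of_le (by exact_mod_cast him)).contDiffAt), norm_smul, Real.norm_eq_abs,
    mul_assoc]
  exact mul_le_mul_of_nonneg_left (hbf i hi p hp) (abs_nonneg c)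

/-- **Scalar multiple** (real-valued map). [folklore] -/
private theorem norm_iteratedFDeriv_const_mul_le {m : ℕ} {T : Set (ℝ × ℝ)} {f : ℝ × ℝ → ℝ} {K θ : ℝ} (c : ℝ)
    (hf : ContDiff ℝ m f) (hbf : ∀ i ≤ m, ∀ p ∈ T, ‖iteratedFDeriv ℝ i f p‖ ≤ K * θ ^ i) :
    ∀ i ≤ m, ∀ p ∈ T, ‖iteratedFDeriv ℝ i (fun q => c * f q) p‖ ≤ (|c| * K) * θ ^ i :=
  norm_iteratedFDeriv_const_smul_le c hf hbf

/-- **Constants**: `‖D^i c‖ ≤ ‖c‖·θ^i` for `θ ≥ 1`. [folklore] -/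
private theorem norm_iteratedFDeriv_const_le (m : ℕ) (T : Set (ℝ × ℝ)) (c : F) {θ : ℝ} (hθ : 1 ≤ θ) :
    ∀ i ≤ m, ∀ p ∈ T, ‖iteratedFDeriv ℝ i (fun _ : ℝ × ℝ => c) p‖ ≤ ‖c‖ * θ ^ i := by
  intro i _ p _
  rcases Nat.eq_zero_or_pos i with h0 | hpos
  · subst h0
    rw [norm_iteratedFDeriv_zero, pow_zero, mul_one]
  · rw [iteratedFDeriv_const_of_ne (Nat.pos_iff_ne_zero.mp hpos) c]
    simp only [Pi.zero_apply, norm_zero]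
    exact mul_nonneg (norm_nonneg _) (pow_nonneg (zero_le_one.trans hθ) _)

/-- **Monotonicity in the constants.** [folklore] -/
private theorem bound_mono {m : ℕ} {T : Set (ℝ × ℝ)} {f : ℝ × ℝ → F} {K K' θ θ' : ℝ} (hK : K ≤ K') (hθ0 : 0 ≤ θ)
    (hθ : θ ≤ θ') (hK' : 0 ≤ K') (hbf : ∀ i ≤ m, ∀ p ∈ T, ‖iteratedFDeriv ℝ i f p‖ ≤ K * θ ^ i) :
    ∀ i ≤ m, ∀ p ∈ T, ‖iteratedFDeriv ℝ i f p‖ ≤ K' * θ' ^ i := fun i hi p hp =>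
  (hbf i hi p hp).trans (mul_le_mul hK (pow_le_pow_left₀ hθ0 hθ i) (pow_nonneg hθ0 _) hK')

/-- **Composition with the first projection**: bounds on `D^i g` transfer to `p ↦ g p.1` (`‖pr₁‖ ≤ 1`).
[folklore] -/
private theorem norm_iteratedFDeriv_comp_fst_le {m : ℕ} {T : Set (ℝ × ℝ)} {g : ℝ → F} {K θ : ℝ}
    (hg : ContDiff ℝ m g) (hK : 0 ≤ K) (hθ : 0 ≤ θ) (hb : ∀ i ≤ m, ∀ p ∈ T, ‖iteratedFDeriv ℝ i g p.1‖ ≤ K * θ ^ i) :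
    ∀ i ≤ m, ∀ p ∈ T, ‖iteratedFDeriv ℝ i (fun q : ℝ × ℝ => g q.1) p‖ ≤ K * θ ^ i := by
  intro i hi p hp
  have him : (i : WithTop ℕ∞) ≤ m := by exact_mod_cast hi
  have e : (fun q : ℝ × ℝ => g q.1) = g ∘ (ContinuousLinearMap.fst ℝ ℝ ℝ) := rfl
  rw [e, ContinuousLinearMap.iteratedFDeriv_comp_right _ hg p him]
  refine (ContinuousMultilinearMap.norm_compContinuousLinearMap_le _ _).trans ?_
  have hprod : ∏ _i : Fin i, ‖ContinuousLinearMap.fst ℝ ℝ ℝ‖ ≤ 1 :=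
    Finset.prod_le_one (fun _ _ => norm_nonneg _) fun _ _ => ContinuousLinearMap.norm_fst_le ℝ ℝ ℝ
  calc ‖iteratedFDeriv ℝ i g ((ContinuousLinearMap.fst ℝ ℝ ℝ) p)‖ * ∏ _i : Fin i, ‖ContinuousLinearMap.fst ℝ ℝ ℝ‖
      ≤ (K * θ ^ i) * 1 := mul_le_mul (hb i hi p hp) hprod (Finset.prod_nonneg fun _ _ => norm_nonneg _)
          (mul_nonneg hK (pow_nonneg hθ _))
    _ = K * θ ^ i := mul_one _

/-- **Squared norm** (Leibniz for the bilinear inner product, `‖⟨·,·⟩‖ ≤ 1`): if `‖D^i v‖ ≤ Kθ^i` (`i ≤ m`) then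
`‖D^i |v|²‖ ≤ K²(2θ)^i`. [folklore] -/
private theorem norm_iteratedFDeriv_norm_sq_le {m : ℕ} {T : Set (ℝ × ℝ)} {v : ℝ × ℝ → EuclideanSpace ℝ (Fin N)}
    {K θ : ℝ} (hv : ContDiff ℝ m v) (hK : 0 ≤ K) (hθ : 0 ≤ θ)
    (hb : ∀ i ≤ m, ∀ p ∈ T, ‖iteratedFDeriv ℝ i v p‖ ≤ K * θ ^ i) :
    ∀ i ≤ m, ∀ p ∈ T, ‖iteratedFDeriv ℝ i (fun q => ‖v q‖ ^ 2) p‖ ≤ K ^ 2 * (2 * θ) ^ i := by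
  intro i hi p hp
  have him : (i : WithTop ℕ∞) ≤ m := by exact_mod_cast hi
  have e : (fun q => ‖v q‖ ^ 2) = fun q => (innerSL ℝ (v q)) (v q) := by
    funext q
    rw [innerSL_apply_apply, real_inner_self_eq_norm_sq]
  have hB : ‖(innerSL ℝ : EuclideanSpace ℝ (Fin N) →L[ℝ] EuclideanSpace ℝ (Fin N) →L[ℝ] ℝ)‖ ≤ 1 :=
    ContinuousLinearMap.opNorm_le_bound _ zero_le_one fun x => by rw [innerSL_apply_norm, one_mul]
  rw [e]
  refine (ContinuousLinearMap.norm_iteratedFDeriv_le_of_bilinear_of_le_one (innerSL ℝ) hv hv p him hB).trans ?_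
  calc ∑ j ∈ Finset.range (i + 1), (i.choose j : ℝ) * ‖iteratedFDeriv ℝ j v p‖ * ‖iteratedFDeriv ℝ (i - j) v p‖
      ≤ ∑ j ∈ Finset.range (i + 1), (i.choose j : ℝ) * (K * θ ^ j) * (K * θ ^ (i - j)) := by
        refine Finset.sum_le_sum fun j hj => ?_
        have hji : j ≤ i := Nat.lt_succ_iff.mp (Finset.mem_range.mp hj)
        exact mul_le_mul (mul_le_mul_of_nonneg_left (hb j (hji.trans hi) p hp) (Nat.cast_nonneg _))
          (hb (i - j) ((Nat.sub_le i j).trans hi) p hp) (norm_nonneg _)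
          (mul_nonneg (Nat.cast_nonneg _) (mul_nonneg hK (pow_nonneg hθ _)))
    _ = K ^ 2 * ∑ j ∈ Finset.range (i + 1), (i.choose j : ℝ) * θ ^ j * θ ^ (i - j) := by
        rw [Finset.mul_sum]
        exact Finset.sum_congr rfl fun j _ => by ring
    _ = K ^ 2 * (2 * θ) ^ i := by rw [sum_choose_mul_pow_eq]

/-- **Composition with the second projection** (`‖pr₂‖ ≤ 1`). [folklore] -/
private theorem norm_iteratedFDeriv_comp_snd_le {m : ℕ} {T : Set (ℝ × ℝ)} {g : ℝ → F} {K θ : ℝ}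
    (hg : ContDiff ℝ m g) (hK : 0 ≤ K) (hθ : 0 ≤ θ) (hb : ∀ i ≤ m, ∀ p ∈ T, ‖iteratedFDeriv ℝ i g p.2‖ ≤ K * θ ^ i) :
    ∀ i ≤ m, ∀ p ∈ T, ‖iteratedFDeriv ℝ i (fun q : ℝ × ℝ => g q.2) p‖ ≤ K * θ ^ i := by
  intro i hi p hp
  have him : (i : WithTop ℕ∞) ≤ m := by exact_mod_cast hi
  have e : (fun q : ℝ × ℝ => g q.2) = g ∘ (ContinuousLinearMap.snd ℝ ℝ ℝ) := rfl
  rw [e, ContinuousLinearMap.iteratedFDeriv_comp_right _ hg p him]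
  refine (ContinuousMultilinearMap.norm_compContinuousLinearMap_le _ _).trans ?_
  have hprod : ∏ _i : Fin i, ‖ContinuousLinearMap.snd ℝ ℝ ℝ‖ ≤ 1 :=
    Finset.prod_le_one (fun _ _ => norm_nonneg _) fun _ _ => ContinuousLinearMap.norm_snd_le ℝ ℝ ℝ
  calc ‖iteratedFDeriv ℝ i g ((ContinuousLinearMap.snd ℝ ℝ ℝ) p)‖ * ∏ _i : Fin i, ‖ContinuousLinearMap.snd ℝ ℝ ℝ‖
      ≤ (K * θ ^ i) * 1 := mul_le_mul (hb i hi p hp) hprod (Finset.prod_nonneg fun _ _ => norm_nonneg _)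
          (mul_nonneg hK (pow_nonneg hθ _))
    _ = K * θ ^ i := mul_one _

/-- The iterated derivatives of `t ↦ t·c`: `t·c`, `c`, `0`, `0`, …. [folklore] -/
private theorem iteratedDeriv_mul_const_id (c : ℝ) :
    ∀ i : ℕ, iteratedDeriv i (fun t : ℝ => t * c) = fun t => if i = 0 then t * c else if i = 1 then c else 0
  | 0 => by funext t; simp
  | 1 => by
      funext t
      rw [iteratedDeriv_one]
      simp
  | i + 2 => by
      funext t
      rw [iteratedDeriv_succ', show deriv (fun t : ℝ => t * c) = fun _ => c from by funext t; simp,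
        iteratedDeriv_const]
      simp

/-- **The linear term `p ↦ p.2·c`**: `‖D^i(p ↦ p.2·c)‖ ≤ R|c|·θ^i` on a set where `|p.2| ≤ R` (`1 ≤ R`, `1 ≤ θ`).
[folklore] -/
private theorem norm_iteratedFDeriv_snd_mul_le (m : ℕ) {T : Set (ℝ × ℝ)} (c : ℝ) {R θ : ℝ} (hR : 1 ≤ R) (hθ : 1 ≤ θ)
    (hT : ∀ p ∈ T, |p.2| ≤ R) :
    ∀ i ≤ m, ∀ p ∈ T, ‖iteratedFDeriv ℝ i (fun q : ℝ × ℝ => q.2 * c) p‖ ≤ (R * |c|) * θ ^ i := by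
  have hR0 : 0 ≤ R := zero_le_one.trans hR
  have hθ0 : 0 ≤ θ := zero_le_one.trans hθ
  have hg : ContDiff ℝ m (fun t : ℝ => t * c) := contDiff_id.mul contDiff_const
  refine norm_iteratedFDeriv_comp_snd_le (g := fun t : ℝ => t * c) hg (mul_nonneg hR0 (abs_nonneg c)) hθ0 ?_
  intro i _ p hp
  rw [norm_iteratedFDeriv_eq_norm_iteratedDeriv, iteratedDeriv_mul_const_id c i]
  have h1 : R * |c| ≤ R * |c| * θ ^ i :=
    le_mul_of_one_le_right (mul_nonneg hR0 (abs_nonneg c)) (one_le_pow₀ hθ)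
  split_ifs with h0 h1'
  · rw [Real.norm_eq_abs, abs_mul]
    exact (mul_le_mul_of_nonneg_right (hT p hp) (abs_nonneg c)).trans h1
  · rw [Real.norm_eq_abs]
    exact (le_mul_of_one_le_left (abs_nonneg c) hR).trans h1
  · rw [norm_zero]
    exact (mul_nonneg hR0 (abs_nonneg c)).trans h1

end Toolbox

/-! ## 1. The transport along an affine charge path `e′ ↦ U(c + e′a)w` and its derivatives -/

section UPath

/-- The TRANSPORT ALONG AN AFFINE CHARGE PATH: `t ↦ U_η(c + t·a)w = exp(qηe(c + ta))w` ((I.1.7) p. 605) — how the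
charge `e′` of (1.4) enters the block averages `Q_k(e′g_kA′ + A^{(k)})` (`η = 1`, `c = A^{(k)}(Γ)`, `a = a_x(A′)`,
(1.3)) and the covariant derivatives `D^η_{e′g_kA′+A^{(k)}}` (`c = A^{(k)}(b)`, `a = G_b(A′)`). (ours)
[cite: Balaban1982Higgs1, (1.7) p.605] -/
noncomputable def uPath (C : HiggsLattice.ChargeData N) (η c a : ℝ) (w : EuclideanSpace ℝ (Fin N)) (t : ℝ) :
    EuclideanSpace ℝ (Fin N) :=
  C.U η (c + t * a) w

/-- Unfolding of `uPath`. [cite: Balaban1982Higgs1, (1.7) p.605] -/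
theorem uPath_def (C : HiggsLattice.ChargeData N) (η c a : ℝ) (w : EuclideanSpace ℝ (Fin N)) (t : ℝ) :
    uPath C η c a w t = C.U η (c + t * a) w := rfl

/-- `d/dt U_η(c + ta)w = (ηea·q)(U_η(c + ta)w)` (`U(A) = exp(qηeA)`). [cite: Balaban1982Higgs1, (1.7) p.605] -/
theorem hasDerivAt_uPath (C : HiggsLattice.ChargeData N) (η c a : ℝ) (w : EuclideanSpace ℝ (Fin N)) (t : ℝ) :
    HasDerivAt (uPath C η c a w) (((η * C.e * a) • C.q) (uPath C η c a w t)) t := by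
  have hθ : HasDerivAt (fun s : ℝ => η * C.e * (c + s * a)) (η * C.e * a) t := by
    refine ((((hasDerivAt_id t).mul_const a).const_add c).const_mul (η * C.e)).congr_deriv ?_
    ring
  have hexp : HasDerivAt (fun u : ℝ => NormedSpace.exp (u • C.q))
      (C.q * NormedSpace.exp ((η * C.e * (c + t * a)) • C.q)) (η * C.e * (c + t * a)) :=
    hasDerivAt_exp_smul_const' C.q _
  have hcomp := hexp.scomp t hθ
  have h := ((ContinuousLinearMap.apply ℝ (EuclideanSpace ℝ (Fin N)) w).hasFDerivAt).comp_hasDerivAt t hcomp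
  have e : uPath C η c a w = fun s => (ContinuousLinearMap.apply ℝ (EuclideanSpace ℝ (Fin N)) w)
      (NormedSpace.exp ((η * C.e * (c + s * a)) • C.q)) := by
    funext s; rfl
  rw [e]
  refine h.congr_deriv ?_
  simp only [ContinuousLinearMap.apply_apply, smul_apply, mul_apply_eq_comp, map_smul]

/-- **`∂ⁱ_t U_η(c + ta)w = (ηea·q)ⁱ U_η(c + ta)w`.** [cite: Balaban1982Higgs1, (1.7) p.605] -/
theorem iteratedDeriv_uPath (C : HiggsLattice.ChargeData N) (η c a : ℝ) (w : EuclideanSpace ℝ (Fin N)) :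
    ∀ i : ℕ, iteratedDeriv i (uPath C η c a w) = fun t => (((η * C.e * a) • C.q) ^ i) (uPath C η c a w t)
  | 0 => by
      funext t
      rw [iteratedDeriv_zero, pow_zero, one_apply_eq_self]
  | i + 1 => by
      funext t
      rw [iteratedDeriv_succ, iteratedDeriv_uPath C η c a w i]
      have h : HasDerivAt (fun s => (((η * C.e * a) • C.q) ^ i) (uPath C η c a w s))
          ((((η * C.e * a) • C.q) ^ i) (((η * C.e * a) • C.q) (uPath C η c a w t))) t :=
        ((((η * C.e * a) • C.q) ^ i).hasFDerivAt).comp_hasDerivAt t (hasDerivAt_uPath C η c a w t)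
      rw [h.deriv, pow_succ, mul_apply_eq_comp]

/-- The transport path is `C^n` for every `n`. [cite: Balaban1982Higgs1, (1.7) p.605] -/
theorem contDiff_uPath (C : HiggsLattice.ChargeData N) (η c a : ℝ) (w : EuclideanSpace ℝ (Fin N)) {n : ℕ∞} :
    ContDiff ℝ n (uPath C η c a w) := by
  -- every path of this family is differentiable with derivative a fixed linear map of a path of the family
  have hd : ∀ c', Differentiable ℝ (uPath C η c' a w) := fun c' t => (hasDerivAt_uPath C η c' a w t).differentiableAt
  have hderiv : ∀ c', deriv (uPath C η c' a w) = fun t => ((η * C.e * a) • C.q) (uPath C η c' a w t) :=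
    fun c' => funext fun t => (hasDerivAt_uPath C η c' a w t).deriv
  have hnat : ∀ m : ℕ, ∀ c', ContDiff ℝ m (uPath C η c' a w) := by
    intro m
    induction m with
    | zero => intro c'; exact contDiff_zero.2 (hd c').continuous
    | succ m ih =>
      intro c'
      refine (contDiff_succ_iff_deriv (n := (m : WithTop ℕ∞))).2 ⟨hd c', fun h => ?_, ?_⟩
      · exact absurd h (by exact_mod_cast WithTop.coe_ne_top)
      · rw [hderiv c']
        exact ((η * C.e * a) • C.q).contDiff.comp (ih c')
  have hinf : ContDiff ℝ (⊤ : ℕ∞) (uPath C η c a w) := contDiff_infty.2 fun m => hnat m c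
  exact hinf.of_le (by exact_mod_cast le_top)

/-- `‖T^i v‖ ≤ ‖T‖^i ‖v‖` for a continuous linear map `T`. [folklore] -/
private theorem norm_pow_apply_le (T : EuclideanSpace ℝ (Fin N) →L[ℝ] EuclideanSpace ℝ (Fin N)) :
    ∀ (i : ℕ) (v : EuclideanSpace ℝ (Fin N)), ‖(T ^ i) v‖ ≤ ‖T‖ ^ i * ‖v‖
  | 0, v => by simp
  | i + 1, v => by
      rw [pow_succ, mul_apply_eq_comp, pow_succ]
      calc ‖(T ^ i) (T v)‖ ≤ ‖T‖ ^ i * ‖T v‖ := norm_pow_apply_le T i (T v)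
        _ ≤ ‖T‖ ^ i * (‖T‖ * ‖v‖) := mul_le_mul_of_nonneg_left (T.le_opNorm v) (pow_nonneg (norm_nonneg _) _)
        _ = ‖T‖ ^ i * ‖T‖ * ‖v‖ := by ring

/-- **`|∂ⁱ_t U_η(c + ta)w| ≤ (|η||e||a|)ⁱ|w|`** (`U` unitary, `‖q‖ ≤ 1`, p. 605). [cite: Balaban1982Higgs1, (1.7) p.605] -/
theorem norm_iteratedDeriv_uPath_le (C : HiggsLattice.ChargeData N) (η c a : ℝ) (w : EuclideanSpace ℝ (Fin N))
    (i : ℕ) (t : ℝ) : ‖iteratedDeriv i (uPath C η c a w) t‖ ≤ (|η| * |C.e| * |a|) ^ i * ‖w‖ := by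
  rw [iteratedDeriv_uPath C η c a w i]
  have hT : ‖(η * C.e * a) • C.q‖ ≤ |η| * |C.e| * |a| := by
    rw [norm_smul, Real.norm_eq_abs, abs_mul, abs_mul]
    exact mul_le_of_le_one_right (by positivity) C.norm_q_le
  calc ‖(((η * C.e * a) • C.q) ^ i) (uPath C η c a w t)‖
      ≤ ‖(η * C.e * a) • C.q‖ ^ i * ‖uPath C η c a w t‖ := norm_pow_apply_le _ i _
    _ ≤ (|η| * |C.e| * |a|) ^ i * ‖w‖ := by
        rw [uPath_def, B1Ineq233Upper.norm_U_apply]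
        exact mul_le_mul_of_nonneg_right (pow_le_pow_left₀ (norm_nonneg _) hT i) (norm_nonneg _)

/-- The same bound for the Fréchet-derivative norm, UNIFORMLY along the path: if `|η||e||a| ≤ θ` then
`‖D^i(uPath)(t)‖ ≤ ‖w‖·θ^i`. [cite: Balaban1982Higgs1, (1.7) p.605] -/
theorem norm_iteratedFDeriv_uPath_le (C : HiggsLattice.ChargeData N) (η c a : ℝ) (w : EuclideanSpace ℝ (Fin N))
    {θ : ℝ} (hθ : |η| * |C.e| * |a| ≤ θ) (i : ℕ) (t : ℝ) :
    ‖iteratedFDeriv ℝ i (uPath C η c a w) t‖ ≤ ‖w‖ * θ ^ i := by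
  rw [norm_iteratedFDeriv_eq_norm_iteratedDeriv]
  refine (norm_iteratedDeriv_uPath_le C η c a w i t).trans ?_
  rw [mul_comm]
  exact mul_le_mul_of_nonneg_left (pow_le_pow_left₀ (by positivity) hθ i) (norm_nonneg _)

end UPath

/-! ## 2. The total exponent `W(e′, λ′)` of the integrand of (1.4) -/

section TotalExponent

variable {k : ℕ} (D : Data14 P N k)

/-- The TOTAL EXPONENT of the integrand `t(Ω;φ,φ′)·exp[…](φ′)` of (1.4) as a function of the two expansion
parameters `p = (e′, λ′)` of (1.5), for fixed fields `A^{(k)}`, `φ` and a fixed point `z = (A′, φ′↾_Ω)` of the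
product of the fluctuation space with the fibre:
`W(e′,λ′) = ½κΣ_{y∈Ω^{(k)}}|φ(y) − (Q_k(e′g_kA′+A^{(k)})φ′)(y)|² + ½⟨φ′,(−Δ^η_{e′g_kA′+A^{(k)},Ω} + m²(L^kε)²)φ′⟩
+ λ′λ(L^kε)Σ_{x∈Ω₁}η^d|φ′(x)|⁴ + ½Σ_{x∈Ω₁}η^dδm²(e′,λ′,x)(L^kε)²|φ′(x)|² + E₁(e′,λ′)` (`κ = a_k(L^kη)^{d−2}`,
`φ′ = φ′↾_Ω` extended by `0`), so that `t·exp[…] = (κ/2π)^{N|Ω^{(k)}|/2}e^{−W}` (`kernel14_mul_density14_eq`). (ours)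
[cite: Balaban1983Higgs3, (1.4) p.412] -/
noncomputable def totalExponent (Ak : HiggsLattice.VecField P 0) (φ : HiggsLattice.ScalarField P k N)
    (z : ((i : Fin k) → HiggsLattice.VecField P i) × (↥D.Ω → EuclideanSpace ℝ (Fin N))) (p : ℝ × ℝ) : ℝ :=
  prec (B1.aSeq D.a P.L k) (P.mesh k) P.d / 2
      * ∑ y : ↥D.Ωk, ‖φ y.1 - D.avgQ14 Ak p.1 z.1 (extendZero D.Ω z.2) y.1‖ ^ 2
    + ((1 / 2 : ℝ) * siteInner (extendZero D.Ω z.2) (D.scalarOp Ak p.1 z.1 (extendZero D.Ω z.2))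
      + p.2 * D.lamRun * ∑ x ∈ D.Ω₁, P.mesh 0 ^ P.d * ‖extendZero D.Ω z.2 x‖ ^ 4
      + (1 / 2 : ℝ) * ∑ x ∈ D.Ω₁, P.mesh 0 ^ P.d * D.dm2 p.1 p.2 x * D.ell ^ 2 * ‖extendZero D.Ω z.2 x‖ ^ 2
      + D.E1 p.1 p.2)

/-- Unfolding of `totalExponent`. [cite: Balaban1983Higgs3, (1.4) p.412] -/
theorem totalExponent_def (Ak : HiggsLattice.VecField P 0) (φ : HiggsLattice.ScalarField P k N)
    (z : ((i : Fin k) → HiggsLattice.VecField P i) × (↥D.Ω → EuclideanSpace ℝ (Fin N))) (p : ℝ × ℝ) :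
    totalExponent D Ak φ z p
      = prec (B1.aSeq D.a P.L k) (P.mesh k) P.d / 2
          * ∑ y : ↥D.Ωk, ‖φ y.1 - D.avgQ14 Ak p.1 z.1 (extendZero D.Ω z.2) y.1‖ ^ 2
        + ((1 / 2 : ℝ) * siteInner (extendZero D.Ω z.2) (D.scalarOp Ak p.1 z.1 (extendZero D.Ω z.2))
          + p.2 * D.lamRun * ∑ x ∈ D.Ω₁, P.mesh 0 ^ P.d * ‖extendZero D.Ω z.2 x‖ ^ 4
          + (1 / 2 : ℝ) * ∑ x ∈ D.Ω₁, P.mesh 0 ^ P.d * D.dm2 p.1 p.2 x * D.ell ^ 2 * ‖extendZero D.Ω z.2 x‖ ^ 2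
          + D.E1 p.1 p.2) := rfl

/-- **`t(Ω;φ,φ′)·exp[…](φ′) = (κ/2π)^{N|Ω^{(k)}|/2}·exp(−W(e′,λ′))`**: the whole dependence of the integrand of (1.4)
on the expansion parameters `(e′, λ′)` sits in one exponent. [cite: Balaban1983Higgs3, (1.4) p.412] -/
theorem kernel14_mul_density14_eq (Ak : HiggsLattice.VecField P 0) (φ : HiggsLattice.ScalarField P k N)
    (z : ((i : Fin k) → HiggsLattice.VecField P i) × (↥D.Ω → EuclideanSpace ℝ (Fin N))) (p : ℝ × ℝ) :
    D.kernel14 Ak p.1 z.1 φ z.2 * D.density14 Ak p.1 p.2 z.1 (extendZero D.Ω z.2)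
      = ((prec (B1.aSeq D.a P.L k) (P.mesh k) P.d / (2 * Real.pi))
            ^ ((Module.finrank ℝ (EuclideanSpace ℝ (Fin N)) : ℝ) / 2)) ^ Fintype.card ↥D.Ωk
          * Real.exp (-totalExponent D Ak φ z p) := by
  set κ : ℝ := prec (B1.aSeq D.a P.L k) (P.mesh k) P.d with hκ
  set c : ℝ := (κ / (2 * Real.pi)) ^ ((Module.finrank ℝ (EuclideanSpace ℝ (Fin N)) : ℝ) / 2) with hc
  have hprod : D.kernel14 Ak p.1 z.1 φ z.2
      = c ^ Fintype.card ↥D.Ωk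
          * Real.exp (∑ y : ↥D.Ωk, -(κ / 2) * ‖φ y.1 - D.avgQ14 Ak p.1 z.1 (extendZero D.Ω z.2) y.1‖ ^ 2) := by
    rw [Data14.kernel14_eq]
    simp only [rtKernel_eq]
    rw [Finset.prod_mul_distrib, Finset.prod_const, Finset.card_univ, Real.exp_sum]
  rw [hprod, Data14.density14_eq, mul_assoc, ← Real.exp_add, totalExponent_def]
  congr 2
  rw [← Finset.mul_sum]
  ring

/-! ### The pieces of `W` as functions of `p = (e′, λ′)`: smoothness and derivative bounds -/

/-- `Σ_{x∈B}|φ′(x)| ≤ |T_η| + Σ_x|φ′(x)|²`. [folklore] -/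
private theorem sum_norm_le' (B : Finset (HiggsLattice.Site P 0)) (φ' : HiggsLattice.ScalarField P 0 N) :
    ∑ x ∈ B, ‖φ' x‖ ≤ (Fintype.card (HiggsLattice.Site P 0) : ℝ) + sqSum φ' := by
  have h1 : ∀ v : EuclideanSpace ℝ (Fin N), ‖v‖ ≤ 1 + ‖v‖ ^ 2 := fun v => by
    nlinarith [sq_nonneg (‖v‖ - 1), norm_nonneg v]
  calc ∑ x ∈ B, ‖φ' x‖ ≤ ∑ x, ‖φ' x‖ :=
        Finset.sum_le_sum_of_subset_of_nonneg (Finset.subset_univ B) fun x _ _ => norm_nonneg _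
    _ ≤ ∑ x : HiggsLattice.Site P 0, (1 + ‖φ' x‖ ^ 2) := Finset.sum_le_sum fun x _ => h1 (φ' x)
    _ = (Fintype.card (HiggsLattice.Site P 0) : ℝ) + sqSum φ' := by
        rw [Finset.sum_add_distrib, Finset.sum_const, Finset.card_univ, nsmul_eq_mul, mul_one, sqSum]

/-- The block average of (1.4) as a combination of transports along affine charge paths:
`(Q_k(e′g_kA′+A^{(k)})φ′)(y) = L^{−kd}Σ_{x∈B^k(y)} U_1(A^{(k)}(Γ) + e′a_x(A′))φ′(x)`. [cite: Balaban1983Higgs3, (1.3)–(1.4) p.412] -/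
theorem avgQ14_eq_sum_uPath (Ak : HiggsLattice.VecField P 0) (A' : (j : Fin k) → HiggsLattice.VecField P j)
    (φ' : HiggsLattice.ScalarField P 0 N) (y : HiggsLattice.Site P k) :
    (fun p : ℝ × ℝ => D.avgQ14 Ak p.1 A' φ' y)
      = fun p => (((P.L : ℝ) ^ (k * P.d))⁻¹) •
          ∑ x ∈ blockK k y, uPath D.C 1 (etaSumK Ak k x) (fluctContour D A' x) (φ' x) p.1 := by
  funext p
  rw [Data14.avgQ14_apply]
  congr 1
  refine Finset.sum_congr rfl fun x _ => ?_
  rw [uPath_def, holK13, contour13_extPieces]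

/-- `p ↦ (Q_k(e′g_kA′+A^{(k)})φ′)(y)` is smooth. [cite: Balaban1983Higgs3, (1.3)–(1.4) p.412] -/
theorem contDiff_avgQ14 (Ak : HiggsLattice.VecField P 0) (A' : (j : Fin k) → HiggsLattice.VecField P j)
    (φ' : HiggsLattice.ScalarField P 0 N) (y : HiggsLattice.Site P k) {n : ℕ∞} :
    ContDiff ℝ n (fun p : ℝ × ℝ => D.avgQ14 Ak p.1 A' φ' y) := by
  rw [avgQ14_eq_sum_uPath]
  exact (ContDiff.sum fun x _ => (contDiff_uPath D.C 1 _ _ (φ' x)).comp contDiff_fst).const_smul _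

/-- `|L^{−kd}| ≤ 1`. [folklore] -/
private theorem abs_Lk_inv_le_one : |(((P.L : ℝ) ^ (k * P.d))⁻¹)| ≤ 1 := by
  have hL : (1 : ℝ) ≤ (P.L : ℝ) := by exact_mod_cast P.hL
  rw [abs_of_nonneg (by positivity)]
  exact inv_le_one_of_one_le₀ (one_le_pow₀ hL)

/-- **Derivative bound of the block average**: `‖D^i_p (Q_kφ′)(y)‖ ≤ (|T_η| + Σ|φ′|²)·θ₀^i` whenever
`|e||a_x(A′)| ≤ θ₀` for all `x`. [cite: Balaban1983Higgs3, (1.3)–(1.4) p.412] -/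
theorem norm_iteratedFDeriv_avgQ14_le (m : ℕ) (Ak : HiggsLattice.VecField P 0)
    (A' : (j : Fin k) → HiggsLattice.VecField P j) (φ' : HiggsLattice.ScalarField P 0 N) (y : HiggsLattice.Site P k)
    {θ₀ : ℝ} (hθ₀ : 0 ≤ θ₀) (hθa : ∀ x, |(1 : ℝ)| * |D.C.e| * |fluctContour D A' x| ≤ θ₀) :
    ∀ i ≤ m, ∀ p ∈ (Set.univ : Set (ℝ × ℝ)),
      ‖iteratedFDeriv ℝ i (fun p : ℝ × ℝ => D.avgQ14 Ak p.1 A' φ' y) p‖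
        ≤ ((Fintype.card (HiggsLattice.Site P 0) : ℝ) + sqSum φ') * θ₀ ^ i := by
  rw [avgQ14_eq_sum_uPath]
  have hf : ∀ x ∈ blockK k y, ContDiff ℝ m
      (fun p : ℝ × ℝ => uPath D.C 1 (etaSumK Ak k x) (fluctContour D A' x) (φ' x) p.1) :=
    fun x _ => (contDiff_uPath D.C 1 _ _ (φ' x)).comp contDiff_fst
  have hb : ∀ x ∈ blockK k y, ∀ i ≤ m, ∀ p ∈ (Set.univ : Set (ℝ × ℝ)),
      ‖iteratedFDeriv ℝ i (fun p : ℝ × ℝ => uPath D.C 1 (etaSumK Ak k x) (fluctContour D A' x) (φ' x) p.1) p‖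
        ≤ ‖φ' x‖ * θ₀ ^ i :=
    fun x _ => norm_iteratedFDeriv_comp_fst_le (contDiff_uPath D.C 1 _ _ (φ' x)) (norm_nonneg _) hθ₀
      fun i _ p _ => norm_iteratedFDeriv_uPath_le D.C 1 _ _ (φ' x) (hθa x) i p.1
  have hsum := norm_iteratedFDeriv_sum_le (blockK k y) hf hb
  have hsmul := norm_iteratedFDeriv_const_smul_le (((P.L : ℝ) ^ (k * P.d))⁻¹) (ContDiff.sum hf) hsum
  refine bound_mono ?_ hθ₀ le_rfl (add_nonneg (Nat.cast_nonneg _) (sqSum_nonneg _)) hsmul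
  calc |(((P.L : ℝ) ^ (k * P.d))⁻¹)| * ∑ x ∈ blockK k y, ‖φ' x‖
      ≤ 1 * ∑ x ∈ blockK k y, ‖φ' x‖ :=
        mul_le_mul_of_nonneg_right abs_Lk_inv_le_one (Finset.sum_nonneg fun x _ => norm_nonneg _)
    _ ≤ (Fintype.card (HiggsLattice.Site P 0) : ℝ) + sqSum φ' := by rw [one_mul]; exact sum_norm_le' _ φ'

/-- **The kernel part of `W`**: `p ↦ ½κΣ_{y∈Ω^{(k)}}|φ(y) − (Q_kφ′)(y)|²` is smooth, with
`‖D^i‖ ≤ ½κ|Ω^{(k)}|(‖φ‖ + |T_η| + Σ|φ′|²)²·(2θ₀)^i` (`θ₀ ≥ 1` as above). [cite: Balaban1983Higgs3, (1.4) p.412] -/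
theorem kernelExponent_bound (m : ℕ) (ha : 0 ≤ D.a) (Ak : HiggsLattice.VecField P 0)
    (A' : (j : Fin k) → HiggsLattice.VecField P j) (φ : HiggsLattice.ScalarField P k N)
    (φ' : HiggsLattice.ScalarField P 0 N) {θ₀ : ℝ} (hθ₀ : 1 ≤ θ₀)
    (hθa : ∀ x, |(1 : ℝ)| * |D.C.e| * |fluctContour D A' x| ≤ θ₀) :
    ContDiff ℝ m (fun p : ℝ × ℝ => prec (B1.aSeq D.a P.L k) (P.mesh k) P.d / 2
        * ∑ y : ↥D.Ωk, ‖φ y.1 - D.avgQ14 Ak p.1 A' φ' y.1‖ ^ 2) ∧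
    ∀ i ≤ m, ∀ p ∈ (Set.univ : Set (ℝ × ℝ)),
      ‖iteratedFDeriv ℝ i (fun p : ℝ × ℝ => prec (B1.aSeq D.a P.L k) (P.mesh k) P.d / 2
          * ∑ y : ↥D.Ωk, ‖φ y.1 - D.avgQ14 Ak p.1 A' φ' y.1‖ ^ 2) p‖
        ≤ (prec (B1.aSeq D.a P.L k) (P.mesh k) P.d / 2 * (Fintype.card ↥D.Ωk
            * (‖φ‖ + ((Fintype.card (HiggsLattice.Site P 0) : ℝ) + sqSum φ')) ^ 2)) * (2 * θ₀) ^ i := by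
  have hθ₀0 : 0 ≤ θ₀ := zero_le_one.trans hθ₀
  set n₀ : ℝ := (Fintype.card (HiggsLattice.Site P 0) : ℝ) + sqSum φ' with hn₀
  have hn₀0 : 0 ≤ n₀ := add_nonneg (Nat.cast_nonneg _) (sqSum_nonneg _)
  have hκ0 : 0 ≤ prec (B1.aSeq D.a P.L k) (P.mesh k) P.d / 2 := by
    unfold prec
    exact div_nonneg (mul_nonneg (D.aSeq_nonneg' ha k) (zpow_nonneg (P.mesh_pos k).le _)) zero_le_two
  -- each `v_y = φ(y) − (Q_kφ′)(y)`
  have hv : ∀ y : ↥D.Ωk, ContDiff ℝ m (fun p : ℝ × ℝ => φ y.1 - D.avgQ14 Ak p.1 A' φ' y.1) ∧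
      ∀ i ≤ m, ∀ p ∈ (Set.univ : Set (ℝ × ℝ)),
        ‖iteratedFDeriv ℝ i (fun p : ℝ × ℝ => φ y.1 - D.avgQ14 Ak p.1 A' φ' y.1) p‖ ≤ (‖φ‖ + n₀) * θ₀ ^ i := by
    intro y
    have hc : ContDiff ℝ m (fun _ : ℝ × ℝ => φ y.1) := contDiff_const
    have hcb := norm_iteratedFDeriv_const_le m (Set.univ : Set (ℝ × ℝ)) (φ y.1) hθ₀
    have hcb' := bound_mono (norm_le_pi_norm φ y.1) hθ₀0 le_rfl (norm_nonneg φ) hcb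
    exact ⟨hc.sub (contDiff_avgQ14 D Ak A' φ' y.1),
      norm_iteratedFDeriv_sub_le hc (contDiff_avgQ14 D Ak A' φ' y.1) hcb'
        (norm_iteratedFDeriv_avgQ14_le D m Ak A' φ' y.1 hθ₀0 hθa)⟩
  -- squares
  have hsq : ∀ y : ↥D.Ωk, ContDiff ℝ m (fun p : ℝ × ℝ => ‖φ y.1 - D.avgQ14 Ak p.1 A' φ' y.1‖ ^ 2) ∧
      ∀ i ≤ m, ∀ p ∈ (Set.univ : Set (ℝ × ℝ)),
        ‖iteratedFDeriv ℝ i (fun p : ℝ × ℝ => ‖φ y.1 - D.avgQ14 Ak p.1 A' φ' y.1‖ ^ 2) p‖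
          ≤ (‖φ‖ + n₀) ^ 2 * (2 * θ₀) ^ i :=
    fun y => ⟨(hv y).1.norm_sq ℝ, norm_iteratedFDeriv_norm_sq_le (hv y).1
      (add_nonneg (norm_nonneg _) hn₀0) hθ₀0 (hv y).2⟩
  have hsum := norm_iteratedFDeriv_sum_le (Finset.univ : Finset ↥D.Ωk) (fun y _ => (hsq y).1) (fun y _ => (hsq y).2)
  have hsumc : ContDiff ℝ m (fun p : ℝ × ℝ => ∑ y : ↥D.Ωk, ‖φ y.1 - D.avgQ14 Ak p.1 A' φ' y.1‖ ^ 2) :=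
    ContDiff.sum fun y _ => (hsq y).1
  refine ⟨contDiff_const.mul hsumc, ?_⟩
  have h := norm_iteratedFDeriv_const_mul_le (prec (B1.aSeq D.a P.L k) (P.mesh k) P.d / 2) hsumc hsum
  rw [Finset.sum_const, Finset.card_univ, nsmul_eq_mul, abs_of_nonneg hκ0] at h
  exact h

/-- The covariant derivative of (1.4) along a bond as a transport along an affine charge path:
`(D^η_{e′g_kA′+A^{(k)}}φ′)(b) = η⁻¹(U_η(A^{(k)}(b) + e′G_b(A′))φ′(b₊) − φ′(b₋))`. [cite: Balaban1982Higgs1, (1.7) p.605] -/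
theorem covDeriv_eq_uPath (Ak : HiggsLattice.VecField P 0) (A' : (j : Fin k) → HiggsLattice.VecField P j)
    (φ' : HiggsLattice.ScalarField P 0 N) (b : HiggsLattice.PBond P 0) :
    (fun p : ℝ × ℝ => covDeriv D.C (D.extField Ak p.1 A') φ' b)
      = fun p => (P.mesh 0)⁻¹ • (uPath D.C (P.mesh 0) (Ak b) (fluctBond D A' b) (φ' b.tgt) p.1 - φ' b.src) := by
  funext p
  rw [covDeriv, extField_apply, uPath_def]

/-- **Derivative bound of the covariant derivative**: `‖D^i_p (D^η_{𝒜}φ′)(b)‖ ≤ η⁻¹(|φ′(b₊)| + |φ′(b₋)|)·θ₀^i`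
whenever `η|e||G_b(A′)| ≤ θ₀` (`θ₀ ≥ 1`). [cite: Balaban1982Higgs1, (1.7) p.605] -/
theorem covDeriv_bound (m : ℕ) (Ak : HiggsLattice.VecField P 0) (A' : (j : Fin k) → HiggsLattice.VecField P j)
    (φ' : HiggsLattice.ScalarField P 0 N) (b : HiggsLattice.PBond P 0) {θ₀ : ℝ} (hθ₀ : 1 ≤ θ₀)
    (hθb : ∀ b, |P.mesh 0| * |D.C.e| * |fluctBond D A' b| ≤ θ₀) :
    ContDiff ℝ m (fun p : ℝ × ℝ => covDeriv D.C (D.extField Ak p.1 A') φ' b) ∧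
    ∀ i ≤ m, ∀ p ∈ (Set.univ : Set (ℝ × ℝ)),
      ‖iteratedFDeriv ℝ i (fun p : ℝ × ℝ => covDeriv D.C (D.extField Ak p.1 A') φ' b) p‖
        ≤ ((P.mesh 0)⁻¹ * (‖φ' b.tgt‖ + ‖φ' b.src‖)) * θ₀ ^ i := by
  have hθ₀0 : 0 ≤ θ₀ := zero_le_one.trans hθ₀
  have hη : 0 < P.mesh 0 := P.mesh_pos 0
  rw [covDeriv_eq_uPath]
  have hu : ContDiff ℝ m (fun p : ℝ × ℝ => uPath D.C (P.mesh 0) (Ak b) (fluctBond D A' b) (φ' b.tgt) p.1) :=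
    (contDiff_uPath D.C _ _ _ _).comp contDiff_fst
  have hub : ∀ i ≤ m, ∀ p ∈ (Set.univ : Set (ℝ × ℝ)),
      ‖iteratedFDeriv ℝ i (fun p : ℝ × ℝ => uPath D.C (P.mesh 0) (Ak b) (fluctBond D A' b) (φ' b.tgt) p.1) p‖
        ≤ ‖φ' b.tgt‖ * θ₀ ^ i :=
    norm_iteratedFDeriv_comp_fst_le (contDiff_uPath D.C _ _ _ _) (norm_nonneg _) hθ₀0
      fun i _ p _ => norm_iteratedFDeriv_uPath_le D.C _ _ _ _ (hθb b) i p.1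
  have hc : ContDiff ℝ m (fun _ : ℝ × ℝ => φ' b.src) := contDiff_const
  have hcb := norm_iteratedFDeriv_const_le m (Set.univ : Set (ℝ × ℝ)) (φ' b.src) hθ₀
  have hsub := norm_iteratedFDeriv_sub_le hu hc hub hcb
  refine ⟨(hu.sub hc).const_smul _, ?_⟩
  have h := norm_iteratedFDeriv_const_smul_le ((P.mesh 0)⁻¹) (hu.sub hc) hsub
  rw [abs_of_pos (inv_pos.2 hη)] at h
  exact h

/-- `⟨φ′, φ′⟩ = η^d Σ_x|φ′(x)|²`. [cite: Balaban1982Higgs1, (1.5) p.604] -/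
theorem siteInner_self_eq_sqSum (φ' : HiggsLattice.ScalarField P 0 N) : siteInner φ' φ' = P.mesh 0 ^ P.d * sqSum φ' := by
  rw [siteInner, sqSum, Finset.mul_sum]
  refine Finset.sum_congr rfl fun x _ => ?_
  rw [real_inner_self_eq_norm_sq]

/-- The quadratic form of (1.4) as a sum of squared covariant derivatives plus the mass term:
`½⟨φ′,(−Δ^η_{𝒜,Ω} + m²(L^kε)²)φ′⟩ = ½Σ_{b⊂Ω}η^d|(D_𝒜φ′)(b)|² + ½m²(L^kε)²⟨φ′,φ′⟩`
(`HiggsCovariancePos.siteInner_covLaplacianN`). [cite: Balaban1983Higgs3, (1.4) p.412] -/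
theorem half_siteInner_scalarOp_eq (Ak : HiggsLattice.VecField P 0) (A' : (j : Fin k) → HiggsLattice.VecField P j)
    (φ' : HiggsLattice.ScalarField P 0 N) :
    (fun p : ℝ × ℝ => (1 / 2 : ℝ) * siteInner φ' (D.scalarOp Ak p.1 A' φ'))
      = fun p => (1 / 2 : ℝ) * (∑ b : HiggsLattice.PBond P 0, if Inside D.Ω b then
            P.mesh 0 ^ P.d * ‖covDeriv D.C (D.extField Ak p.1 A') φ' b‖ ^ 2 else 0)
          + (1 / 2 : ℝ) * (D.m2 * D.ell ^ 2 * siteInner φ' φ') := by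
  funext p
  rw [Data14.scalarOp_eq, LinearMap.add_apply, LinearMap.smul_apply, LinearMap.id_apply,
    HiggsFluctMeasurePos.siteInner_add_right, HiggsFluctMeasurePos.siteInner_smul_right, siteInner_covLaplacianN,
    mul_add]
  congr 2
  refine Finset.sum_congr rfl fun b _ => ?_
  split_ifs
  · rw [real_inner_self_eq_norm_sq]
  · rfl

/-- **The Dirichlet part of `W`**: `p ↦ ½⟨φ′,(−Δ^η_{e′g_kA′+A^{(k)},Ω} + m²(L^kε)²)φ′⟩` is smooth, with
`‖D^i‖ ≤ (2|bonds|η^{d}η^{−2} + ½|m²|(L^kε)²η^d)·Σ|φ′|²·(2θ₀)^i`. [cite: Balaban1983Higgs3, (1.4) p.412] -/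
theorem dirichletExponent_bound (m : ℕ) (Ak : HiggsLattice.VecField P 0)
    (A' : (j : Fin k) → HiggsLattice.VecField P j) (φ' : HiggsLattice.ScalarField P 0 N) {θ₀ : ℝ} (hθ₀ : 1 ≤ θ₀)
    (hθb : ∀ b, |P.mesh 0| * |D.C.e| * |fluctBond D A' b| ≤ θ₀) :
    ContDiff ℝ m (fun p : ℝ × ℝ => (1 / 2 : ℝ) * siteInner φ' (D.scalarOp Ak p.1 A' φ')) ∧
    ∀ i ≤ m, ∀ p ∈ (Set.univ : Set (ℝ × ℝ)),
      ‖iteratedFDeriv ℝ i (fun p : ℝ × ℝ => (1 / 2 : ℝ) * siteInner φ' (D.scalarOp Ak p.1 A' φ')) p‖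
        ≤ ((2 * Fintype.card (HiggsLattice.PBond P 0) * (P.mesh 0 ^ P.d * (P.mesh 0)⁻¹ ^ 2)
            + (1 / 2 : ℝ) * (|D.m2| * D.ell ^ 2 * P.mesh 0 ^ P.d)) * sqSum φ') * (2 * θ₀) ^ i := by
  have hθ₀0 : 0 ≤ θ₀ := zero_le_one.trans hθ₀
  have h2θ : 1 ≤ 2 * θ₀ := by linarith
  have hη : 0 < P.mesh 0 := P.mesh_pos 0
  have hηd : 0 ≤ P.mesh 0 ^ P.d := pow_nonneg hη.le _
  have hS0 : 0 ≤ sqSum φ' := sqSum_nonneg _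
  rw [half_siteInner_scalarOp_eq]
  -- the bond terms
  have hb : ∀ b : HiggsLattice.PBond P 0,
      ContDiff ℝ m (fun p : ℝ × ℝ => if Inside D.Ω b then
          P.mesh 0 ^ P.d * ‖covDeriv D.C (D.extField Ak p.1 A') φ' b‖ ^ 2 else 0) ∧
      ∀ i ≤ m, ∀ p ∈ (Set.univ : Set (ℝ × ℝ)),
        ‖iteratedFDeriv ℝ i (fun p : ℝ × ℝ => if Inside D.Ω b then
            P.mesh 0 ^ P.d * ‖covDeriv D.C (D.extField Ak p.1 A') φ' b‖ ^ 2 else 0) p‖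
          ≤ (4 * (P.mesh 0 ^ P.d * (P.mesh 0)⁻¹ ^ 2) * sqSum φ') * (2 * θ₀) ^ i := by
    intro b
    by_cases hin : Inside D.Ω b
    · simp only [hin, if_true]
      obtain ⟨hcd, hcdb⟩ := covDeriv_bound D m Ak A' φ' b hθ₀ hθb
      have hsq := norm_iteratedFDeriv_norm_sq_le hcd (by positivity) hθ₀0 hcdb
      have hmul := norm_iteratedFDeriv_const_mul_le (P.mesh 0 ^ P.d) (hcd.norm_sq ℝ) hsq
      refine ⟨contDiff_const.mul (hcd.norm_sq ℝ), bound_mono ?_ (by positivity) le_rfl (by positivity) hmul⟩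
      rw [abs_of_nonneg hηd]
      have h1 := sq_le_sqSum φ' b.tgt
      have h2 := sq_le_sqSum φ' b.src
      have h3 : (‖φ' b.tgt‖ + ‖φ' b.src‖) ^ 2 ≤ 4 * sqSum φ' := by
        nlinarith [norm_nonneg (φ' b.tgt), norm_nonneg (φ' b.src), sq_nonneg (‖φ' b.tgt‖ - ‖φ' b.src‖)]
      calc P.mesh 0 ^ P.d * ((P.mesh 0)⁻¹ * (‖φ' b.tgt‖ + ‖φ' b.src‖)) ^ 2
          = (P.mesh 0 ^ P.d * (P.mesh 0)⁻¹ ^ 2) * (‖φ' b.tgt‖ + ‖φ' b.src‖) ^ 2 := by ring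
        _ ≤ (P.mesh 0 ^ P.d * (P.mesh 0)⁻¹ ^ 2) * (4 * sqSum φ') := mul_le_mul_of_nonneg_left h3 (by positivity)
        _ = 4 * (P.mesh 0 ^ P.d * (P.mesh 0)⁻¹ ^ 2) * sqSum φ' := by ring
    · simp only [hin, if_false]
      refine ⟨contDiff_const, ?_⟩
      have h0 := norm_iteratedFDeriv_const_le m (Set.univ : Set (ℝ × ℝ)) (0 : ℝ) h2θ
      rw [norm_zero] at h0
      exact bound_mono (by positivity) (by positivity) le_rfl (by positivity) h0
  have hsum := norm_iteratedFDeriv_sum_le (Finset.univ : Finset (HiggsLattice.PBond P 0)) (fun b _ => (hb b).1)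
    (fun b _ => (hb b).2)
  have hsumc : ContDiff ℝ m (fun p : ℝ × ℝ => ∑ b : HiggsLattice.PBond P 0, if Inside D.Ω b then
      P.mesh 0 ^ P.d * ‖covDeriv D.C (D.extField Ak p.1 A') φ' b‖ ^ 2 else 0) := ContDiff.sum fun b _ => (hb b).1
  have hhalf := norm_iteratedFDeriv_const_mul_le (1 / 2 : ℝ) hsumc hsum
  rw [Finset.sum_const, Finset.card_univ, nsmul_eq_mul, abs_of_pos (by norm_num : (0 : ℝ) < 1 / 2)] at hhalf
  -- the mass term (constant in `p`)
  have hmass := norm_iteratedFDeriv_const_le m (Set.univ : Set (ℝ × ℝ))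
    ((1 / 2 : ℝ) * (D.m2 * D.ell ^ 2 * siteInner φ' φ')) h2θ
  have hmassK : ‖(1 / 2 : ℝ) * (D.m2 * D.ell ^ 2 * siteInner φ' φ')‖
      = (1 / 2 : ℝ) * (|D.m2| * D.ell ^ 2 * P.mesh 0 ^ P.d) * sqSum φ' := by
    have hY0 : 0 ≤ (1 / 2 : ℝ) * D.ell ^ 2 * P.mesh 0 ^ P.d * sqSum φ' := by positivity
    rw [siteInner_self_eq_sqSum, Real.norm_eq_abs,
      show (1 / 2 : ℝ) * (D.m2 * D.ell ^ 2 * (P.mesh 0 ^ P.d * sqSum φ'))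
        = D.m2 * ((1 / 2 : ℝ) * D.ell ^ 2 * P.mesh 0 ^ P.d * sqSum φ') by ring,
      abs_mul, abs_of_nonneg hY0]
    ring
  rw [hmassK] at hmass
  refine ⟨(contDiff_const.mul hsumc).add contDiff_const, ?_⟩
  have h := norm_iteratedFDeriv_add_le (contDiff_const.mul hsumc) contDiff_const hhalf hmass
  refine bound_mono (le_of_eq ?_) (by positivity) le_rfl (by positivity) h
  ring

/-- The quartic of `Ω₁` is at most `η^d(Σ_x|φ′(x)|²)²`. [folklore] -/
private theorem quartic_le_sqSum_sq' (φ' : HiggsLattice.ScalarField P 0 N) :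
    ∑ x ∈ D.Ω₁, P.mesh 0 ^ P.d * ‖φ' x‖ ^ 4 ≤ P.mesh 0 ^ P.d * (sqSum φ') ^ 2 := by
  have hη : 0 < P.mesh 0 ^ P.d := pow_pos (P.mesh_pos 0) _
  rw [← Finset.mul_sum]
  refine mul_le_mul_of_nonneg_left ?_ hη.le
  have h1 : ∑ x ∈ D.Ω₁, ‖φ' x‖ ^ 4 ≤ ∑ x ∈ D.Ω₁, sqSum φ' * ‖φ' x‖ ^ 2 := by
    refine Finset.sum_le_sum fun x _ => ?_
    have hx := sq_le_sqSum φ' x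
    nlinarith [sq_nonneg ‖φ' x‖]
  have h2 : ∑ x ∈ D.Ω₁, sqSum φ' * ‖φ' x‖ ^ 2 ≤ sqSum φ' * sqSum φ' := by
    rw [← Finset.mul_sum]
    refine mul_le_mul_of_nonneg_left ?_ (sqSum_nonneg φ')
    unfold sqSum
    exact Finset.sum_le_sum_of_subset_of_nonneg (Finset.subset_univ _) fun x _ _ => sq_nonneg _
  nlinarith [h1, h2]

/-- **The quartic part of `W`**: `p ↦ λ′λ(L^kε)Σ_{x∈Ω₁}η^d|φ′(x)|⁴` is smooth (linear in `λ′`), with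
`‖D^i‖ ≤ (|λ′₀| + 1)|λ(L^kε)|η^d(Σ|φ′|²)²·θ^i` on the ball `B((e′₀,λ′₀), 1)` for any `θ ≥ 1`.
[cite: Balaban1983Higgs3, (1.4), (1.6) pp.412–413] -/
theorem quarticExponent_bound (m : ℕ) (φ' : HiggsLattice.ScalarField P 0 N) (p₀ : ℝ × ℝ) {θ : ℝ} (hθ : 1 ≤ θ) :
    ContDiff ℝ m (fun p : ℝ × ℝ => p.2 * D.lamRun * ∑ x ∈ D.Ω₁, P.mesh 0 ^ P.d * ‖φ' x‖ ^ 4) ∧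
    ∀ i ≤ m, ∀ p ∈ closedBall p₀ 1,
      ‖iteratedFDeriv ℝ i (fun p : ℝ × ℝ => p.2 * D.lamRun * ∑ x ∈ D.Ω₁, P.mesh 0 ^ P.d * ‖φ' x‖ ^ 4) p‖
        ≤ ((|p₀.2| + 1) * (|D.lamRun| * P.mesh 0 ^ P.d) * (sqSum φ') ^ 2) * θ ^ i := by
  have hηd : 0 ≤ P.mesh 0 ^ P.d := pow_nonneg (P.mesh_pos 0).le _
  have e : (fun p : ℝ × ℝ => p.2 * D.lamRun * ∑ x ∈ D.Ω₁, P.mesh 0 ^ P.d * ‖φ' x‖ ^ 4)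
      = fun p : ℝ × ℝ => p.2 * (D.lamRun * ∑ x ∈ D.Ω₁, P.mesh 0 ^ P.d * ‖φ' x‖ ^ 4) := by
    funext p; ring
  rw [e]
  refine ⟨contDiff_snd.mul contDiff_const, ?_⟩
  have hT : ∀ p ∈ closedBall p₀ (1 : ℝ), |p.2| ≤ |p₀.2| + 1 := by
    intro p hp
    have h1 : |p.2 - p₀.2| ≤ 1 := by
      have h := (mem_closedBall.1 hp)
      rw [dist_eq_norm] at h
      exact (Real.norm_eq_abs _ ▸ norm_snd_le (p - p₀)).trans h
    have := abs_sub_abs_le_abs_sub p.2 p₀.2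
    linarith
  have h := norm_iteratedFDeriv_snd_mul_le m (D.lamRun * ∑ x ∈ D.Ω₁, P.mesh 0 ^ P.d * ‖φ' x‖ ^ 4)
    (R := |p₀.2| + 1) (by linarith [abs_nonneg p₀.2]) hθ hT
  refine bound_mono ?_ (zero_le_one.trans hθ) le_rfl (by positivity) h
  have hV0 : 0 ≤ ∑ x ∈ D.Ω₁, P.mesh 0 ^ P.d * ‖φ' x‖ ^ 4 := Finset.sum_nonneg fun x _ => by positivity
  rw [abs_mul, abs_of_nonneg hV0]
  have hq := quartic_le_sqSum_sq' D φ'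
  calc (|p₀.2| + 1) * (|D.lamRun| * ∑ x ∈ D.Ω₁, P.mesh 0 ^ P.d * ‖φ' x‖ ^ 4)
      ≤ (|p₀.2| + 1) * (|D.lamRun| * (P.mesh 0 ^ P.d * (sqSum φ') ^ 2)) :=
        mul_le_mul_of_nonneg_left (mul_le_mul_of_nonneg_left hq (abs_nonneg _)) (by positivity)
    _ = (|p₀.2| + 1) * (|D.lamRun| * P.mesh 0 ^ P.d) * (sqSum φ') ^ 2 := by ring

/-- A function of class `C^m` on `ℝ × ℝ` has all its derivatives of order `≤ m` bounded on a closed unit ball.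
[folklore] -/
private theorem exists_bound_iteratedFDeriv_closedBall {m : ℕ} {f : ℝ × ℝ → ℝ} (hf : ContDiff ℝ m f) (p₀ : ℝ × ℝ) :
    ∃ B : ℝ, 0 ≤ B ∧ ∀ i ≤ m, ∀ p ∈ closedBall p₀ 1, ‖iteratedFDeriv ℝ i f p‖ ≤ B := by
  have heach : ∀ i : ℕ, ∃ B : ℝ, 0 ≤ B ∧ (i ≤ m → ∀ p ∈ closedBall p₀ 1, ‖iteratedFDeriv ℝ i f p‖ ≤ B) := by
    intro i
    by_cases hi : i ≤ m
    · have him : (i : WithTop ℕ∞) ≤ m := by exact_mod_cast hi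
      obtain ⟨C, hC⟩ := (isCompact_closedBall p₀ (1 : ℝ)).exists_bound_of_continuousOn
        ((hf.continuous_iteratedFDeriv him).continuousOn)
      exact ⟨max C 0, le_max_right _ _, fun _ p hp => (hC p hp).trans (le_max_left _ _)⟩
    · exact ⟨0, le_rfl, fun h => absurd h hi⟩
  choose B hB0 hB using heach
  refine ⟨∑ i ∈ Finset.range (m + 1), B i, Finset.sum_nonneg fun i _ => hB0 i, fun i hi p hp => ?_⟩
  exact (hB i hi p hp).trans (Finset.single_le_sum (fun j _ => hB0 j) (Finset.mem_range.2 (Nat.lt_succ_of_le hi)))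

/-- **The mass-counterterm part of `W`**: `p ↦ ½Σ_{x∈Ω₁}η^dδm²(e′,λ′,x)(L^kε)²|φ′(x)|²` is `C^m` for `C^m` data,
with `‖D^i‖ ≤ ½η^d(L^kε)²B_δ·Σ|φ′|²·θ^i` on the ball `B(p₀, 1)` (`B_δ` a bound of the data derivatives there, `θ ≥ 1`).
[cite: Balaban1983Higgs3, (1.4), (1.7) pp.412–413] -/
theorem massExponent_bound {m : ℕ} (hdm2 : ∀ x ∈ D.Ω₁, ContDiff ℝ m (fun p : ℝ × ℝ => D.dm2 p.1 p.2 x))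
    (φ' : HiggsLattice.ScalarField P 0 N) (p₀ : ℝ × ℝ) {Bd θ : ℝ} (hBd0 : 0 ≤ Bd) (hθ : 1 ≤ θ)
    (hBd : ∀ x ∈ D.Ω₁, ∀ i ≤ m, ∀ p ∈ closedBall p₀ 1, ‖iteratedFDeriv ℝ i (fun p : ℝ × ℝ => D.dm2 p.1 p.2 x) p‖ ≤ Bd) :
    ContDiff ℝ m (fun p : ℝ × ℝ =>
        (1 / 2 : ℝ) * ∑ x ∈ D.Ω₁, P.mesh 0 ^ P.d * D.dm2 p.1 p.2 x * D.ell ^ 2 * ‖φ' x‖ ^ 2) ∧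
    ∀ i ≤ m, ∀ p ∈ closedBall p₀ 1,
      ‖iteratedFDeriv ℝ i (fun p : ℝ × ℝ =>
          (1 / 2 : ℝ) * ∑ x ∈ D.Ω₁, P.mesh 0 ^ P.d * D.dm2 p.1 p.2 x * D.ell ^ 2 * ‖φ' x‖ ^ 2) p‖
        ≤ ((1 / 2 : ℝ) * (P.mesh 0 ^ P.d * D.ell ^ 2 * Bd) * sqSum φ') * θ ^ i := by
  have hηd : 0 ≤ P.mesh 0 ^ P.d := pow_nonneg (P.mesh_pos 0).le _
  have hθ0 : 0 ≤ θ := zero_le_one.trans hθ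
  have hS0 : 0 ≤ sqSum φ' := sqSum_nonneg _
  have e : (fun p : ℝ × ℝ => (1 / 2 : ℝ) * ∑ x ∈ D.Ω₁, P.mesh 0 ^ P.d * D.dm2 p.1 p.2 x * D.ell ^ 2 * ‖φ' x‖ ^ 2)
      = fun p : ℝ × ℝ => (1 / 2 : ℝ) * ∑ x ∈ D.Ω₁, (P.mesh 0 ^ P.d * D.ell ^ 2 * ‖φ' x‖ ^ 2) * D.dm2 p.1 p.2 x := by
    funext p
    congr 1
    exact Finset.sum_congr rfl fun x _ => by ring
  rw [e]
  have hx : ∀ x ∈ D.Ω₁, ContDiff ℝ m (fun p : ℝ × ℝ => (P.mesh 0 ^ P.d * D.ell ^ 2 * ‖φ' x‖ ^ 2) * D.dm2 p.1 p.2 x) ∧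
      ∀ i ≤ m, ∀ p ∈ closedBall p₀ 1,
        ‖iteratedFDeriv ℝ i (fun p : ℝ × ℝ => (P.mesh 0 ^ P.d * D.ell ^ 2 * ‖φ' x‖ ^ 2) * D.dm2 p.1 p.2 x) p‖
          ≤ ((P.mesh 0 ^ P.d * D.ell ^ 2 * ‖φ' x‖ ^ 2) * Bd) * θ ^ i := by
    intro x hxΩ
    have hb : ∀ i ≤ m, ∀ p ∈ closedBall p₀ 1, ‖iteratedFDeriv ℝ i (fun p : ℝ × ℝ => D.dm2 p.1 p.2 x) p‖ ≤ Bd * θ ^ i :=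
      fun i hi p hp => (hBd x hxΩ i hi p hp).trans (le_mul_of_one_le_right hBd0 (one_le_pow₀ hθ))
    have h := norm_iteratedFDeriv_const_mul_le (P.mesh 0 ^ P.d * D.ell ^ 2 * ‖φ' x‖ ^ 2) (hdm2 x hxΩ) hb
    rw [abs_of_nonneg (by positivity)] at h
    exact ⟨contDiff_const.mul (hdm2 x hxΩ), h⟩
  have hsum := norm_iteratedFDeriv_sum_le D.Ω₁ (fun x hx' => (hx x hx').1) (fun x hx' => (hx x hx').2)
  have hsumc : ContDiff ℝ m (fun p : ℝ × ℝ =>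
      ∑ x ∈ D.Ω₁, (P.mesh 0 ^ P.d * D.ell ^ 2 * ‖φ' x‖ ^ 2) * D.dm2 p.1 p.2 x) := ContDiff.sum fun x hx' => (hx x hx').1
  have h := norm_iteratedFDeriv_const_mul_le (1 / 2 : ℝ) hsumc hsum
  rw [abs_of_pos (by norm_num : (0 : ℝ) < 1 / 2)] at h
  refine ⟨contDiff_const.mul hsumc, bound_mono ?_ hθ0 le_rfl (by positivity) h⟩
  have hS : ∑ x ∈ D.Ω₁, ‖φ' x‖ ^ 2 ≤ sqSum φ' := by
    unfold sqSum
    exact Finset.sum_le_sum_of_subset_of_nonneg (Finset.subset_univ _) fun x _ _ => sq_nonneg _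
  have e2 : ∑ x ∈ D.Ω₁, (P.mesh 0 ^ P.d * D.ell ^ 2 * ‖φ' x‖ ^ 2) * Bd
      = (P.mesh 0 ^ P.d * D.ell ^ 2 * Bd) * ∑ x ∈ D.Ω₁, ‖φ' x‖ ^ 2 := by
    rw [Finset.mul_sum]
    exact Finset.sum_congr rfl fun x _ => by ring
  rw [e2]
  have hX : 0 ≤ (1 / 2 : ℝ) * (P.mesh 0 ^ P.d * D.ell ^ 2 * Bd) := by positivity
  calc (1 / 2 : ℝ) * ((P.mesh 0 ^ P.d * D.ell ^ 2 * Bd) * ∑ x ∈ D.Ω₁, ‖φ' x‖ ^ 2)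
      = ((1 / 2 : ℝ) * (P.mesh 0 ^ P.d * D.ell ^ 2 * Bd)) * ∑ x ∈ D.Ω₁, ‖φ' x‖ ^ 2 := by ring
    _ ≤ ((1 / 2 : ℝ) * (P.mesh 0 ^ P.d * D.ell ^ 2 * Bd)) * sqSum φ' := mul_le_mul_of_nonneg_left hS hX

/-! ### `W` is `C^m` in `p = (e′, λ′)`, with a derivative bound uniform on unit balls -/

/-- `p ↦ (D^η_{e′g_kA′+A^{(k)}}φ′)(b)` is smooth. [cite: Balaban1982Higgs1, (1.7) p.605] -/
theorem contDiff_covDeriv (Ak : HiggsLattice.VecField P 0) (A' : (j : Fin k) → HiggsLattice.VecField P j)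
    (φ' : HiggsLattice.ScalarField P 0 N) (b : HiggsLattice.PBond P 0) {n : ℕ∞} :
    ContDiff ℝ n (fun p : ℝ × ℝ => covDeriv D.C (D.extField Ak p.1 A') φ' b) := by
  rw [covDeriv_eq_uPath]
  exact (((contDiff_uPath D.C _ _ _ _).comp contDiff_fst).sub contDiff_const).const_smul _

/-- **`W` is `C^m` in `p = (e′, λ′)`** whenever the counterterm data `δm²(·,·,x)` (`x ∈ Ω₁`) and `E₁(·,·)` are `C^m`.
[cite: Balaban1983Higgs3, (1.4), (1.7) pp.412–413] -/
theorem contDiff_totalExponent {m : ℕ} (hdm2 : ∀ x ∈ D.Ω₁, ContDiff ℝ m (fun p : ℝ × ℝ => D.dm2 p.1 p.2 x))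
    (hE1 : ContDiff ℝ m (fun p : ℝ × ℝ => D.E1 p.1 p.2)) (Ak : HiggsLattice.VecField P 0)
    (φ : HiggsLattice.ScalarField P k N)
    (z : ((i : Fin k) → HiggsLattice.VecField P i) × (↥D.Ω → EuclideanSpace ℝ (Fin N))) :
    ContDiff ℝ m (totalExponent D Ak φ z) := by
  have hK : ContDiff ℝ m (fun p : ℝ × ℝ => prec (B1.aSeq D.a P.L k) (P.mesh k) P.d / 2
      * ∑ y : ↥D.Ωk, ‖φ y.1 - D.avgQ14 Ak p.1 z.1 (extendZero D.Ω z.2) y.1‖ ^ 2) :=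
    contDiff_const.mul (ContDiff.sum fun y _ => (contDiff_const.sub (contDiff_avgQ14 D Ak z.1 _ y.1)).norm_sq ℝ)
  have hY : ContDiff ℝ m (fun p : ℝ × ℝ =>
      (1 / 2 : ℝ) * siteInner (extendZero D.Ω z.2) (D.scalarOp Ak p.1 z.1 (extendZero D.Ω z.2))) := by
    rw [half_siteInner_scalarOp_eq]
    refine (contDiff_const.mul (ContDiff.sum fun b _ => ?_)).add contDiff_const
    split_ifs
    · exact contDiff_const.mul ((contDiff_covDeriv D Ak z.1 _ b).norm_sq ℝ)
    · exact contDiff_const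
  have hq : ContDiff ℝ m (fun p : ℝ × ℝ =>
      p.2 * D.lamRun * ∑ x ∈ D.Ω₁, P.mesh 0 ^ P.d * ‖extendZero D.Ω z.2 x‖ ^ 4) :=
    (contDiff_snd.mul contDiff_const).mul contDiff_const
  have hm : ContDiff ℝ m (fun p : ℝ × ℝ => (1 / 2 : ℝ) * ∑ x ∈ D.Ω₁,
      P.mesh 0 ^ P.d * D.dm2 p.1 p.2 x * D.ell ^ 2 * ‖extendZero D.Ω z.2 x‖ ^ 2) :=
    contDiff_const.mul (ContDiff.sum fun x hx =>
      ((contDiff_const.mul (hdm2 x hx)).mul contDiff_const).mul contDiff_const)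
  unfold totalExponent
  exact hK.add (((hY.add hq).add hm).add hE1)
set_option maxHeartbeats 400000 in
/-- **Uniform derivative bound for `W`.** For `C^m` counterterm data there is `B ≥ 0` (depending on the data, `m`,
`φ` and the ball `B(p₀, 1) ∋ p`, but not on `z = (A′, φ′_Ω)`) with
`‖D^i_p W(p, z)‖ ≤ B(1 + ‖A′‖)^m(1 + Σ_x|φ′(x)|²)²` for all `i ≤ m`, `p ∈ B(p₀, 1)`: the exponent of (1.4) and all its
`(e′, λ′)`-derivatives grow at most polynomially in the fluctuation fields, the mechanism behind the analyticity /
smoothness statements following (1.4). [cite: Balaban1983Higgs3, (1.4), (1.7) pp.412–413] -/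
theorem exists_norm_iteratedFDeriv_totalExponent_le {m : ℕ} (ha : 0 ≤ D.a)
    (hdm2 : ∀ x ∈ D.Ω₁, ContDiff ℝ m (fun p : ℝ × ℝ => D.dm2 p.1 p.2 x))
    (hE1 : ContDiff ℝ m (fun p : ℝ × ℝ => D.E1 p.1 p.2)) (Ak : HiggsLattice.VecField P 0)
    (φ : HiggsLattice.ScalarField P k N) (p₀ : ℝ × ℝ) :
    ∃ B : ℝ, 0 ≤ B ∧ ∀ (z : ((i : Fin k) → HiggsLattice.VecField P i) × (↥D.Ω → EuclideanSpace ℝ (Fin N))),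
      ∀ i ≤ m, ∀ p ∈ closedBall p₀ 1,
        ‖iteratedFDeriv ℝ i (totalExponent D Ak φ z) p‖
          ≤ B * (1 + ‖z.1‖) ^ m * (1 + sqSum (extendZero D.Ω z.2)) ^ 2 := by
  obtain ⟨Ca, hCa0, hCa⟩ := exists_fluctContour_le D
  obtain ⟨Cg, hCg0, hCg⟩ := exists_fluctBond_le D
  -- bounds of the data derivatives on the ball
  have hBdx : ∀ x : HiggsLattice.Site P 0, ∃ Bx : ℝ, 0 ≤ Bx ∧ (x ∈ D.Ω₁ → ∀ i ≤ m, ∀ p ∈ closedBall p₀ 1,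
      ‖iteratedFDeriv ℝ i (fun p : ℝ × ℝ => D.dm2 p.1 p.2 x) p‖ ≤ Bx) := by
    intro x
    by_cases hx : x ∈ D.Ω₁
    · obtain ⟨Bx, hBx0, hBx⟩ := exists_bound_iteratedFDeriv_closedBall (hdm2 x hx) p₀
      exact ⟨Bx, hBx0, fun _ => hBx⟩
    · exact ⟨0, le_rfl, fun h => absurd h hx⟩
  choose Bx hBx0 hBx using hBdx
  obtain ⟨Bd, hBd0, hBd⟩ : ∃ Bd : ℝ, 0 ≤ Bd ∧ ∀ x ∈ D.Ω₁, ∀ i ≤ m, ∀ p ∈ closedBall p₀ 1,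
      ‖iteratedFDeriv ℝ i (fun p : ℝ × ℝ => D.dm2 p.1 p.2 x) p‖ ≤ Bd :=
    ⟨∑ x, Bx x, Finset.sum_nonneg fun x _ => hBx0 x, fun x hx i hi p hp =>
      (hBx x hx i hi p hp).trans (Finset.single_le_sum (fun y _ => hBx0 y) (Finset.mem_univ x))⟩
  obtain ⟨Be, hBe0, hBe⟩ := exists_bound_iteratedFDeriv_closedBall hE1 p₀
  have hκ : 0 ≤ prec (B1.aSeq D.a P.L k) (P.mesh k) P.d := by
    unfold prec
    exact mul_nonneg (D.aSeq_nonneg' ha k) (zpow_nonneg (P.mesh_pos k).le _)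
  have hηd : 0 ≤ P.mesh 0 ^ P.d := pow_nonneg (P.mesh_pos 0).le _
  refine ⟨(prec (B1.aSeq D.a P.L k) (P.mesh k) P.d / 2 * (Fintype.card ↥D.Ωk * (‖φ‖ + (Fintype.card (HiggsLattice.Site P 0) : ℝ) + 1) ^ 2)
      + (2 * Fintype.card (HiggsLattice.PBond P 0) * (P.mesh 0 ^ P.d * (P.mesh 0)⁻¹ ^ 2)
          + (1 / 2 : ℝ) * (|D.m2| * D.ell ^ 2 * P.mesh 0 ^ P.d))
      + (|p₀.2| + 1) * (|D.lamRun| * P.mesh 0 ^ P.d) + (1 / 2 : ℝ) * (P.mesh 0 ^ P.d * D.ell ^ 2 * Bd) + Be) * (2 * (1 + |D.C.e| * (Ca + |P.mesh 0| * Cg))) ^ m, by positivity, fun z i hi p hp => ?_⟩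
  unfold totalExponent
  set φ' : HiggsLattice.ScalarField P 0 N := extendZero D.Ω z.2 with hφ'
  have hS0 : 0 ≤ sqSum φ' := sqSum_nonneg _
  have hc₀0 : 0 ≤ |D.C.e| * (Ca + |P.mesh 0| * Cg) := by positivity
  have hA0 : 0 ≤ |D.C.e| * (Ca + |P.mesh 0| * Cg) * ‖z.1‖ := mul_nonneg hc₀0 (norm_nonneg _)
  set θ₀ : ℝ := 1 + |D.C.e| * (Ca + |P.mesh 0| * Cg) * ‖z.1‖ with hθ₀
  have hθ₀1 : 1 ≤ θ₀ := by rw [hθ₀]; linarith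
  have h2θ : 1 ≤ 2 * θ₀ := by linarith
  have hθa : ∀ x, |(1 : ℝ)| * |D.C.e| * |fluctContour D z.1 x| ≤ θ₀ := by
    intro x
    rw [abs_one, one_mul, hθ₀]
    have h1 : |D.C.e| * |fluctContour D z.1 x| ≤ |D.C.e| * (Ca * ‖z.1‖) :=
      mul_le_mul_of_nonneg_left (hCa z.1 x) (abs_nonneg _)
    nlinarith [abs_nonneg D.C.e, abs_nonneg (P.mesh 0), mul_nonneg (mul_nonneg (abs_nonneg D.C.e) (abs_nonneg (P.mesh 0)))
      (mul_nonneg hCg0 (norm_nonneg z.1))]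
  have hθb : ∀ b, |P.mesh 0| * |D.C.e| * |fluctBond D z.1 b| ≤ θ₀ := by
    intro b
    rw [hθ₀]
    have h1 : |P.mesh 0| * |D.C.e| * |fluctBond D z.1 b| ≤ |P.mesh 0| * |D.C.e| * (Cg * ‖z.1‖) :=
      mul_le_mul_of_nonneg_left (hCg z.1 b) (by positivity)
    nlinarith [abs_nonneg D.C.e, abs_nonneg (P.mesh 0), mul_nonneg (abs_nonneg D.C.e) (mul_nonneg hCa0 (norm_nonneg z.1))]
  -- the five pieces on `T = B(p₀, 1)` with ratio `2θ₀`
  obtain ⟨hKc, hKb⟩ := kernelExponent_bound D m ha Ak z.1 φ φ' hθ₀1 hθa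
  obtain ⟨hYc, hYb⟩ := dirichletExponent_bound D m Ak z.1 φ' hθ₀1 hθb
  obtain ⟨hqc, hqb⟩ := quarticExponent_bound D m φ' p₀ h2θ
  obtain ⟨hmc, hmb⟩ := massExponent_bound D hdm2 φ' p₀ hBd0 h2θ hBd
  have hEb : ∀ i ≤ m, ∀ p ∈ closedBall p₀ 1,
      ‖iteratedFDeriv ℝ i (fun p : ℝ × ℝ => D.E1 p.1 p.2) p‖ ≤ Be * (2 * θ₀) ^ i :=
    fun i hi p hp => (hBe i hi p hp).trans (le_mul_of_one_le_right hBe0 (one_le_pow₀ h2θ))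
  have hKb' : ∀ i ≤ m, ∀ p ∈ closedBall p₀ 1, ‖iteratedFDeriv ℝ i (fun p : ℝ × ℝ => prec (B1.aSeq D.a P.L k) (P.mesh k) P.d / 2
      * ∑ y : ↥D.Ωk, ‖φ y.1 - D.avgQ14 Ak p.1 z.1 φ' y.1‖ ^ 2) p‖
        ≤ (prec (B1.aSeq D.a P.L k) (P.mesh k) P.d / 2 * (Fintype.card ↥D.Ωk * (‖φ‖ + ((Fintype.card (HiggsLattice.Site P 0) : ℝ) + sqSum φ')) ^ 2)) * (2 * θ₀) ^ i :=
    fun i hi p _ => hKb i hi p (mem_univ p)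
  have hYb' : ∀ i ≤ m, ∀ p ∈ closedBall p₀ 1,
      ‖iteratedFDeriv ℝ i (fun p : ℝ × ℝ => (1 / 2 : ℝ) * siteInner φ' (D.scalarOp Ak p.1 z.1 φ')) p‖
        ≤ ((2 * Fintype.card (HiggsLattice.PBond P 0) * (P.mesh 0 ^ P.d * (P.mesh 0)⁻¹ ^ 2)
            + (1 / 2 : ℝ) * (|D.m2| * D.ell ^ 2 * P.mesh 0 ^ P.d)) * sqSum φ') * (2 * θ₀) ^ i :=
    fun i hi p _ => hYb i hi p (mem_univ p)
  have hsum := norm_iteratedFDeriv_add_le hKc (((hYc.add hqc).add hmc).add hE1) hKb'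
    (norm_iteratedFDeriv_add_le ((hYc.add hqc).add hmc) hE1
      (norm_iteratedFDeriv_add_le (hYc.add hqc) hmc (norm_iteratedFDeriv_add_le hYc hqc hYb' hqb) hmb) hEb)
  refine (hsum i hi p hp).trans ?_
  -- bookkeeping: `K_tot ≤ B₀(1 + S)²` and `(2θ₀)^i ≤ (2(1 + c₀))^m (1 + ‖A′‖)^m`
  have hpow : (2 * θ₀) ^ i ≤ (2 * (1 + |D.C.e| * (Ca + |P.mesh 0| * Cg))) ^ m * (1 + ‖z.1‖) ^ m := by
    rw [← mul_pow]
    calc (2 * θ₀) ^ i ≤ (2 * θ₀) ^ m := pow_le_pow_right₀ h2θ hi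
      _ ≤ (2 * (1 + |D.C.e| * (Ca + |P.mesh 0| * Cg)) * (1 + ‖z.1‖)) ^ m := by
          refine pow_le_pow_left₀ (by linarith) ?_ m
          rw [hθ₀]
          nlinarith [norm_nonneg z.1]
  have hφn : 0 ≤ ‖φ‖ + (Fintype.card (HiggsLattice.Site P 0) : ℝ) := by positivity
  have i1 : (‖φ‖ + ((Fintype.card (HiggsLattice.Site P 0) : ℝ) + sqSum φ')) ^ 2 ≤ (‖φ‖ + (Fintype.card (HiggsLattice.Site P 0) : ℝ) + 1) ^ 2 * (1 + sqSum φ') ^ 2 := by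
    rw [← mul_pow]
    exact pow_le_pow_left₀ (by positivity) (by nlinarith) 2
  have i2 : sqSum φ' ≤ (1 + sqSum φ') ^ 2 := by nlinarith
  have i3 : sqSum φ' ^ 2 ≤ (1 + sqSum φ') ^ 2 := by nlinarith
  have i4 : (1 : ℝ) ≤ (1 + sqSum φ') ^ 2 := by nlinarith
  have j1 := mul_le_mul_of_nonneg_left i1
    (by positivity : (0 : ℝ) ≤ prec (B1.aSeq D.a P.L k) (P.mesh k) P.d / 2 * Fintype.card ↥D.Ωk)
  have j2 := mul_le_mul_of_nonneg_left i2
    (by positivity : (0 : ℝ) ≤ 2 * Fintype.card (HiggsLattice.PBond P 0) * (P.mesh 0 ^ P.d * (P.mesh 0)⁻¹ ^ 2)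
      + (1 / 2 : ℝ) * (|D.m2| * D.ell ^ 2 * P.mesh 0 ^ P.d))
  have j3 := mul_le_mul_of_nonneg_left i3 (by positivity : (0 : ℝ) ≤ (|p₀.2| + 1) * (|D.lamRun| * P.mesh 0 ^ P.d))
  have j4 := mul_le_mul_of_nonneg_left i2 (by positivity : (0 : ℝ) ≤ (1 / 2 : ℝ) * (P.mesh 0 ^ P.d * D.ell ^ 2 * Bd))
  have j5 := mul_le_mul_of_nonneg_left i4 hBe0
  have hKtot :
      prec (B1.aSeq D.a P.L k) (P.mesh k) P.d / 2 * (Fintype.card ↥D.Ωk * (‖φ‖ + ((Fintype.card (HiggsLattice.Site P 0) : ℝ) + sqSum φ')) ^ 2)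
        + ((2 * Fintype.card (HiggsLattice.PBond P 0) * (P.mesh 0 ^ P.d * (P.mesh 0)⁻¹ ^ 2)
              + (1 / 2 : ℝ) * (|D.m2| * D.ell ^ 2 * P.mesh 0 ^ P.d)) * sqSum φ'
            + (|p₀.2| + 1) * (|D.lamRun| * P.mesh 0 ^ P.d) * sqSum φ' ^ 2
            + (1 / 2 : ℝ) * (P.mesh 0 ^ P.d * D.ell ^ 2 * Bd) * sqSum φ' + Be)
      ≤ (prec (B1.aSeq D.a P.L k) (P.mesh k) P.d / 2 * (Fintype.card ↥D.Ωk * (‖φ‖ + (Fintype.card (HiggsLattice.Site P 0) : ℝ) + 1) ^ 2)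
      + (2 * Fintype.card (HiggsLattice.PBond P 0) * (P.mesh 0 ^ P.d * (P.mesh 0)⁻¹ ^ 2)
          + (1 / 2 : ℝ) * (|D.m2| * D.ell ^ 2 * P.mesh 0 ^ P.d))
      + (|p₀.2| + 1) * (|D.lamRun| * P.mesh 0 ^ P.d) + (1 / 2 : ℝ) * (P.mesh 0 ^ P.d * D.ell ^ 2 * Bd) + Be) * (1 + sqSum φ') ^ 2 := by
    linarith [j1, j2, j3, j4, j5]
  have hB₀0 : (0 : ℝ) ≤ (prec (B1.aSeq D.a P.L k) (P.mesh k) P.d / 2 * (Fintype.card ↥D.Ωk * (‖φ‖ + (Fintype.card (HiggsLattice.Site P 0) : ℝ) + 1) ^ 2)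
      + (2 * Fintype.card (HiggsLattice.PBond P 0) * (P.mesh 0 ^ P.d * (P.mesh 0)⁻¹ ^ 2)
          + (1 / 2 : ℝ) * (|D.m2| * D.ell ^ 2 * P.mesh 0 ^ P.d))
      + (|p₀.2| + 1) * (|D.lamRun| * P.mesh 0 ^ P.d) + (1 / 2 : ℝ) * (P.mesh 0 ^ P.d * D.ell ^ 2 * Bd) + Be) := by positivity
  calc _ ≤ ((prec (B1.aSeq D.a P.L k) (P.mesh k) P.d / 2 * (Fintype.card ↥D.Ωk * (‖φ‖ + (Fintype.card (HiggsLattice.Site P 0) : ℝ) + 1) ^ 2)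
      + (2 * Fintype.card (HiggsLattice.PBond P 0) * (P.mesh 0 ^ P.d * (P.mesh 0)⁻¹ ^ 2)
          + (1 / 2 : ℝ) * (|D.m2| * D.ell ^ 2 * P.mesh 0 ^ P.d))
      + (|p₀.2| + 1) * (|D.lamRun| * P.mesh 0 ^ P.d) + (1 / 2 : ℝ) * (P.mesh 0 ^ P.d * D.ell ^ 2 * Bd) + Be) * (1 + sqSum φ') ^ 2) * ((2 * (1 + |D.C.e| * (Ca + |P.mesh 0| * Cg))) ^ m * (1 + ‖z.1‖) ^ m) :=
        mul_le_mul hKtot hpow (by positivity) (by positivity)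
    _ = _ := by ring

end TotalExponent

/-! ## §3 The fibre integrand `t·exp[…] = C_κ·e^{−W}`: smoothness and the Faà di Bruno bound -/

section Fibre

variable {k : ℕ} (D : Data14 P N k)

/-- `j`-th derivative of `u ↦ c·e^{−u}`. [folklore] -/
private theorem iteratedDeriv_const_mul_exp_neg (c : ℝ) : ∀ j : ℕ,
    iteratedDeriv j (fun u : ℝ => c * Real.exp (-u)) = fun u => (-1) ^ j * (c * Real.exp (-u))
  | 0 => by funext u; simp
  | j + 1 => by
      rw [iteratedDeriv_succ, iteratedDeriv_const_mul_exp_neg c j]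
      funext u
      have h : HasDerivAt (fun u : ℝ => (-1) ^ j * (c * Real.exp (-u)))
          ((-1) ^ j * (c * (Real.exp (-u) * (-1)))) u :=
        (((hasDerivAt_id' u).neg.exp).const_mul c).const_mul _
      rw [h.deriv]
      ring

/-- **The fibre integrand of (1.4) is `C^m` in `p = (e′, λ′)`** (for `C^m` counterterm data): it is `C_κ·e^{−W(p,z)}`.
[cite: Balaban1983Higgs3, (1.4) p.412] -/
theorem contDiff_fibre14 {m : ℕ} (hdm2 : ∀ x ∈ D.Ω₁, ContDiff ℝ m (fun p : ℝ × ℝ => D.dm2 p.1 p.2 x))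
    (hE1 : ContDiff ℝ m (fun p : ℝ × ℝ => D.E1 p.1 p.2)) (Ak : HiggsLattice.VecField P 0)
    (φ : HiggsLattice.ScalarField P k N)
    (z : ((i : Fin k) → HiggsLattice.VecField P i) × (↥D.Ω → EuclideanSpace ℝ (Fin N))) :
    ContDiff ℝ m (fun p : ℝ × ℝ =>
      D.kernel14 Ak p.1 z.1 φ z.2 * D.density14 Ak p.1 p.2 z.1 (extendZero D.Ω z.2)) := by
  have e : (fun p : ℝ × ℝ => D.kernel14 Ak p.1 z.1 φ z.2 * D.density14 Ak p.1 p.2 z.1 (extendZero D.Ω z.2))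
      = (fun u : ℝ => ((prec (B1.aSeq D.a P.L k) (P.mesh k) P.d / (2 * Real.pi))
            ^ ((Module.finrank ℝ (EuclideanSpace ℝ (Fin N)) : ℝ) / 2)) ^ Fintype.card ↥D.Ωk * Real.exp (-u))
          ∘ totalExponent D Ak φ z := by
    funext p
    exact kernel14_mul_density14_eq D Ak φ z p
  rw [e]
  exact (contDiff_const.mul contDiff_neg.exp).comp (contDiff_totalExponent D hdm2 hE1 Ak φ z)

/-- **Faà di Bruno bound for the fibre integrand.** With `B` from `exists_norm_iteratedFDeriv_totalExponent_le` and
`M(z) = B(1 + ‖A′‖)^m(1 + Σ_x|φ′(x)|²)²`: for `i ≤ m`, `p ∈ B(p₀, 1)`,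
`‖D^i_p (t·exp[…])(p, z)‖ ≤ i!·max(1, M(z))^i·(t·exp[…])(p, z)` — every `(e′, λ′)`-derivative of the integrand of
(1.4) is the integrand times a polynomial weight in the fluctuation fields (`norm_iteratedFDeriv_comp_le`).
[cite: Balaban1983Higgs3, (1.4), (1.7) pp.412–413] -/
theorem exists_norm_iteratedFDeriv_fibre14_le {m : ℕ} (ha : 0 ≤ D.a)
    (hdm2 : ∀ x ∈ D.Ω₁, ContDiff ℝ m (fun p : ℝ × ℝ => D.dm2 p.1 p.2 x))
    (hE1 : ContDiff ℝ m (fun p : ℝ × ℝ => D.E1 p.1 p.2)) (Ak : HiggsLattice.VecField P 0)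
    (φ : HiggsLattice.ScalarField P k N) (p₀ : ℝ × ℝ) :
    ∃ B : ℝ, 0 ≤ B ∧ ∀ (z : ((i : Fin k) → HiggsLattice.VecField P i) × (↥D.Ω → EuclideanSpace ℝ (Fin N))),
      ∀ i ≤ m, ∀ p ∈ closedBall p₀ 1,
        ‖iteratedFDeriv ℝ i (fun q : ℝ × ℝ =>
            D.kernel14 Ak q.1 z.1 φ z.2 * D.density14 Ak q.1 q.2 z.1 (extendZero D.Ω z.2)) p‖
          ≤ (i.factorial : ℝ) * (max 1 (B * (1 + ‖z.1‖) ^ m * (1 + sqSum (extendZero D.Ω z.2)) ^ 2)) ^ i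
              * (D.kernel14 Ak p.1 z.1 φ z.2 * D.density14 Ak p.1 p.2 z.1 (extendZero D.Ω z.2)) := by
  obtain ⟨B, hB0, hB⟩ := exists_norm_iteratedFDeriv_totalExponent_le D ha hdm2 hE1 Ak φ p₀
  refine ⟨B, hB0, fun z i hi p hp => ?_⟩
  have hκ : 0 ≤ prec (B1.aSeq D.a P.L k) (P.mesh k) P.d := by
    unfold prec
    exact mul_nonneg (D.aSeq_nonneg' ha k) (zpow_nonneg (P.mesh_pos k).le _)
  set c : ℝ := ((prec (B1.aSeq D.a P.L k) (P.mesh k) P.d / (2 * Real.pi))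
            ^ ((Module.finrank ℝ (EuclideanSpace ℝ (Fin N)) : ℝ) / 2)) ^ Fintype.card ↥D.Ωk with hc
  have hc0 : 0 ≤ c := pow_nonneg (Real.rpow_nonneg (div_nonneg hκ (by positivity)) _) _
  set M : ℝ := B * (1 + ‖z.1‖) ^ m * (1 + sqSum (extendZero D.Ω z.2)) ^ 2 with hM
  have e : (fun q : ℝ × ℝ => D.kernel14 Ak q.1 z.1 φ z.2 * D.density14 Ak q.1 q.2 z.1 (extendZero D.Ω z.2))
      = (fun u : ℝ => c * Real.exp (-u)) ∘ totalExponent D Ak φ z := by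
    funext q
    exact kernel14_mul_density14_eq D Ak φ z q
  rw [e, kernel14_mul_density14_eq D Ak φ z p]
  have him : (i : WithTop ℕ∞) ≤ m := by exact_mod_cast hi
  have hg : ContDiff ℝ i (fun u : ℝ => c * Real.exp (-u)) := contDiff_const.mul contDiff_neg.exp
  have hf : ContDiff ℝ i (totalExponent D Ak φ z) := (contDiff_totalExponent D hdm2 hE1 Ak φ z).of_le him
  have hC : ∀ j, j ≤ i → ‖iteratedFDeriv ℝ j (fun u : ℝ => c * Real.exp (-u)) (totalExponent D Ak φ z p)‖
      ≤ c * Real.exp (-totalExponent D Ak φ z p) := by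
    intro j _
    rw [norm_iteratedFDeriv_eq_norm_iteratedDeriv, iteratedDeriv_const_mul_exp_neg, Real.norm_eq_abs, abs_mul,
      abs_pow, abs_neg, abs_one, one_pow, one_mul, abs_of_nonneg (mul_nonneg hc0 (Real.exp_nonneg _))]
  have hD : ∀ j, 1 ≤ j → j ≤ i → ‖iteratedFDeriv ℝ j (totalExponent D Ak φ z) p‖ ≤ (max 1 M) ^ j := by
    intro j hj hji
    calc ‖iteratedFDeriv ℝ j (totalExponent D Ak φ z) p‖ ≤ M := hB z j (hji.trans hi) p hp
      _ ≤ max 1 M := le_max_right _ _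
      _ ≤ (max 1 M) ^ j := le_self_pow₀ (le_max_left 1 M) (by omega)
  have h := norm_iteratedFDeriv_comp_le hg hf le_rfl p hC hD
  calc _ ≤ _ := h
    _ = _ := by ring

end Fibre

end

end Literature.MathematicalPhysics.QuantumFieldTheory.Balaban1983to89.B3Eq14TotalExponent
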